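import Literature.NumberTheory.LFunctions.ZetaZeroDetection
import Literature.NumberTheory.LFunctions.DirichletPolynomialDiscreteMeanValue
import Literature.NumberTheory.LFunctions.DirichletPolynomialGallagher
import Mathlib.Algebra.Order.Chebyshev
import Literature.NumberTheory.LFunctions.ZeroDensityInghamHuxley
import Mathlib.Analysis.PSeries
import Mathlib.Analysis.Convex.SpecificFunctions.Basic
import Mathlib.Analysis.SpecialFunctions.Integrals.Basic
import HarnessLib

/-!
# Tools for Ingham's zero-density estimate: the Class-I and Class-II counts, and the counting layer

Trunk T-ANT, topic `Literature/NumberTheory/LFunctions`. Second layer (after `ZetaZeroDetection.lean`)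
of the proof of the named fact `Literature.NumberTheory.LFunctions.zeroDensity_ingham` (`ZeroCounting.lean`; Ivić 1985, Thm 11.1
(11.22) = Titchmarsh Thm 9.19(B)) by Montgomery's zero-detection method. Everything here is PROVED:

* **Kernel sums over well-spaced points** (`sum_inv_sq_add_sq_le`): for reals pairwise `≥ 1` apart,
  `∑_t 1/(m² + (x-t)²) ≤ 3/m² + 4` (injectivity of `⌊·⌋` on such sets).
* **Cauchy–Schwarz / Hölder `(4,2,4)`** for interval integrals of continuous functions and for finite
  sums, in fourth-power form (`pow_four_integral_mul_mul_le`, `pow_four_sum_sqrt_sqrt_mul_sqrt_le`; the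
  Cauchy–Schwarz step is the tree's `Literature.NumberTheory.LFunctions.Gallagher.integral_mul_le_sqrt_mul_sqrt`).
* **The Class-I count** (`exists_classOne_const`; Ivić §11.3, the bound for `R₁` in the proof of
  (11.22)): if `|∑_{M<n≤2M} b(n) n^{-ρ}| ≥ V` for `1`-spaced `ρ = β+iγ`, `σ ≤ β ≤ σ+1/2`, `|γ| ≤ T`,
  then the number of such `ρ` is `≤ C₀ (T+2M) log(4M) ∑|b(n)|² n^{-2σ} / V²`; the factor `n^{-(β-σ)}`
  is removed by discrete Abel summation, each partial sum being estimated uniformly by the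
  discrete mean value theorem `Literature.NumberTheory.LFunctions.MatomakiRadziwill2016_lemma7` (proved in
  `DirichletPolynomialDiscreteMeanValue.lean`) and Cauchy's inequality.
* **The Class-II count** (`classTwo_core`; Ivić §11.2 (11.10), (11.19)–(11.20) with `A = 4`, in
  integral form): Hölder against the Riesz-kernel weight `|K(1/2-β+iy)|`, then over the zeros,
  reduces `R₂` to the fourth moment of `ζ` and the mean square of `M_X` on `[0, 3T]`.
* **The counting layer** (`WellSpacedBound`, `count_dyadic_le`, `isBigO_of_dyadic`; Ivić (11.11)–
  (11.12)): from a bound `C U^κ` for `1`-spaced sets of zeros with `U < Im ρ ≤ 2U` to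
  `N(σ, 2U) − N(σ, U) ≪ U^κ log U` (unit windows and the Jensen window count
  `Literature.NumberTheory.LFunctions.exists_sum_zetaZeroWindow_le`, representatives split by parity of `⌊Im ρ⌋`) and then to
  `N(σ, T) = O(T^{κ+δ})` by dyadic summation.

## References

* A. Ivić, *The Riemann Zeta-Function*, Wiley 1985, §11.2–§11.3, Thm 11.1, (11.8)–(11.22); Thm 5.3.
* E. C. Titchmarsh, *The Theory of the Riemann Zeta-Function*, 2nd ed. (1986), §9.16–§9.19.
* H. L. Montgomery, *Topics in Multiplicative Number Theory*, LNM 227 (1971), Ch. 12.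
-/

noncomputable section

open Finset Real Complex MeasureTheory intervalIntegral Filter Asymptotics

namespace Literature.NumberTheory.LFunctions

namespace ZeroDensity


/-- On a finite set of reals pairwise `≥ 1` apart, `t ↦ ⌊t⌋` is injective. [folklore] -/
theorem injOn_floor_of_sep (𝒯 : Finset ℝ)
    (hsep : ∀ t ∈ 𝒯, ∀ t' ∈ 𝒯, t ≠ t' → 1 ≤ |t - t'|) :
    Set.InjOn (fun t : ℝ ↦ ⌊t⌋) 𝒯 := by
  intro t ht t' ht' h
  by_contra hne
  have h1 := hsep t ht t' ht' hne
  have h2 := Int.abs_sub_lt_one_of_floor_eq_floor h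
  linarith

/-- `∑_{n=1}^{N} 1/n² ≤ 2`. [folklore] -/
theorem sum_Icc_inv_sq_le_two (N : ℕ) : ∑ n ∈ Finset.Icc 1 N, ((n : ℝ) ^ 2)⁻¹ ≤ 2 := by
  have h := sum_Ioo_inv_sq_le (α := ℝ) 0 (N + 1)
  have e : Finset.Ioo 0 (N + 1) = Finset.Icc 1 N := by
    ext n; simp; omega
  rw [e] at h
  simpa using h

/-- The comparison function `G(i) = 1/m²` for `|i| ≤ 1`, `1/(|i|-1)²` for `|i| ≥ 2`. [folklore] -/
def kernG (m : ℝ) (i : ℤ) : ℝ := if |i| ≤ 1 then (m ^ 2)⁻¹ else (((|i| : ℤ) : ℝ) - 1)⁻¹ ^ 2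

/-- `G ≥ 0`. [folklore] -/
theorem kernG_nonneg (m : ℝ) (i : ℤ) : 0 ≤ kernG m i := by
  unfold kernG; split_ifs <;> positivity

/-- Pointwise comparison: with `j = ⌊x⌋`, `k = ⌊t⌋`, `1/(m² + (x-t)²) ≤ G(k - j)`. [folklore] -/
theorem inv_sq_add_sq_le_kernG {m : ℝ} (hm : 0 < m) (x t : ℝ) :
    (m ^ 2 + (x - t) ^ 2)⁻¹ ≤ kernG m (⌊t⌋ - ⌊x⌋) := by
  unfold kernG
  split_ifs with h
  · exact inv_anti₀ (by positivity) (by nlinarith)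
  · rw [not_le] at h
    -- `|x - t| ≥ |⌊t⌋ - ⌊x⌋| - 1 ≥ 1`
    have hx0 := Int.floor_le x
    have hx1 := Int.lt_floor_add_one x
    have ht0 := Int.floor_le t
    have ht1 := Int.lt_floor_add_one t
    have hpos : (0 : ℝ) < (((|⌊t⌋ - ⌊x⌋| : ℤ)) : ℝ) - 1 := by
      have : (1 : ℝ) < (((|⌊t⌋ - ⌊x⌋| : ℤ)) : ℝ) := by exact_mod_cast h
      linarith
    rw [inv_pow]
    refine inv_anti₀ (pow_pos hpos 2) ?_
    rcases le_total ⌊t⌋ ⌊x⌋ with hle | hle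
    · have habs : |⌊t⌋ - ⌊x⌋| = ⌊x⌋ - ⌊t⌋ := by
        rw [abs_of_nonpos (by omega)]; ring
      rw [habs] at h ⊢
      have h2 : ⌊t⌋ + 2 ≤ ⌊x⌋ := by omega
      have h2' : (⌊t⌋ : ℝ) + 2 ≤ ⌊x⌋ := by exact_mod_cast h2
      push_cast
      nlinarith
    · have habs : |⌊t⌋ - ⌊x⌋| = ⌊t⌋ - ⌊x⌋ := abs_of_nonneg (by omega)
      rw [habs] at h ⊢
      have h2 : ⌊x⌋ + 2 ≤ ⌊t⌋ := by omega
      have h2' : (⌊x⌋ : ℝ) + 2 ≤ ⌊t⌋ := by exact_mod_cast h2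
      push_cast
      nlinarith

/-- The sum of `G` over any finite set of integers is `≤ 3/m² + 4`. [folklore] -/
theorem sum_kernG_le {m : ℝ} (hm : 0 < m) (S : Finset ℤ) :
    ∑ i ∈ S, kernG m i ≤ 3 * (m ^ 2)⁻¹ + 4 := by
  classical
  rw [← Finset.sum_filter_add_sum_filter_not S (fun i : ℤ ↦ |i| ≤ 1)]
  have hA : ∑ i ∈ S.filter (fun i : ℤ ↦ |i| ≤ 1), kernG m i ≤ 3 * (m ^ 2)⁻¹ := by
    have hsub : S.filter (fun i : ℤ ↦ |i| ≤ 1) ⊆ Finset.Icc (-1 : ℤ) 1 := by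
      intro i hi
      simp only [Finset.mem_filter] at hi
      simp only [Finset.mem_Icc]
      exact abs_le.1 hi.2
    calc ∑ i ∈ S.filter (fun i : ℤ ↦ |i| ≤ 1), kernG m i
        = ∑ i ∈ S.filter (fun i : ℤ ↦ |i| ≤ 1), (m ^ 2)⁻¹ :=
          Finset.sum_congr rfl fun i hi ↦ by
            simp only [Finset.mem_filter] at hi; simp [kernG, hi.2]
      _ = (S.filter (fun i : ℤ ↦ |i| ≤ 1)).card * (m ^ 2)⁻¹ := by simp
      _ ≤ 3 * (m ^ 2)⁻¹ := by
          gcongr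
          have := Finset.card_le_card hsub
          simp at this
          exact_mod_cast this
  have hB : ∑ i ∈ S.filter (fun i : ℤ ↦ ¬ |i| ≤ 1), kernG m i ≤ 4 := by
    set S' := S.filter (fun i : ℤ ↦ ¬ |i| ≤ 1) with hS'
    have hval : ∀ i ∈ S', kernG m i = (((|i| : ℤ) : ℝ) - 1)⁻¹ ^ 2 := by
      intro i hi; simp only [hS', Finset.mem_filter] at hi; simp [kernG, hi.2]
    rw [Finset.sum_congr rfl hval]
    -- split into positive and negative parts
    rw [← Finset.sum_filter_add_sum_filter_not S' (fun i : ℤ ↦ 0 ≤ i)]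
    -- positive part: `i ≥ 2`, inject `i ↦ (i - 1).toNat`
    have hP : ∑ i ∈ S'.filter (fun i : ℤ ↦ 0 ≤ i), (((|i| : ℤ) : ℝ) - 1)⁻¹ ^ 2 ≤ 2 := by
      set P := S'.filter (fun i : ℤ ↦ 0 ≤ i) with hP
      have hmem : ∀ i ∈ P, 2 ≤ i := by
        intro i hi
        simp only [hP, hS', Finset.mem_filter, not_le] at hi
        have := hi.1.2; rw [abs_of_nonneg hi.2] at this; omega
      set N : ℕ := P.sup (fun i : ℤ ↦ (i - 1).toNat) with hN
      have hinj : Set.InjOn (fun i : ℤ ↦ (i - 1).toNat) P := by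
        intro i hi i' hi' h
        have h1 := hmem i hi; have h2 := hmem i' hi'
        simp only at h
        omega
      calc ∑ i ∈ P, (((|i| : ℤ) : ℝ) - 1)⁻¹ ^ 2
          = ∑ i ∈ P, (((((i - 1).toNat : ℕ) : ℝ)) ^ 2)⁻¹ := by
            refine Finset.sum_congr rfl fun i hi ↦ ?_
            have h1 := hmem i hi
            rw [abs_of_nonneg (by omega), inv_pow]
            congr 2
            have : ((i - 1).toNat : ℤ) = i - 1 := Int.toNat_of_nonneg (by omega)
            have : (((i - 1).toNat : ℕ) : ℝ) = ((i - 1 : ℤ) : ℝ) := by exact_mod_cast this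
            rw [this]; push_cast; ring
        _ = ∑ n ∈ P.image (fun i : ℤ ↦ (i - 1).toNat), ((n : ℝ) ^ 2)⁻¹ :=
            (Finset.sum_image (f := fun n : ℕ ↦ ((n : ℝ) ^ 2)⁻¹) hinj).symm
        _ ≤ ∑ n ∈ Finset.Icc 1 N, ((n : ℝ) ^ 2)⁻¹ := by
            refine Finset.sum_le_sum_of_subset_of_nonneg (fun n hn ↦ ?_) fun _ _ _ ↦ by positivity
            simp only [Finset.mem_image] at hn
            obtain ⟨i, hi, rfl⟩ := hn
            have h1 := hmem i hi
            have hle : (i - 1).toNat ≤ N := Finset.le_sup (f := fun i : ℤ ↦ (i - 1).toNat) hi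
            simp only [Finset.mem_Icc]
            constructor <;> omega
        _ ≤ 2 := sum_Icc_inv_sq_le_two N
    -- negative part: `i ≤ -2`, inject `i ↦ (-i - 1).toNat`
    have hM : ∑ i ∈ S'.filter (fun i : ℤ ↦ ¬ 0 ≤ i), (((|i| : ℤ) : ℝ) - 1)⁻¹ ^ 2 ≤ 2 := by
      set P := S'.filter (fun i : ℤ ↦ ¬ 0 ≤ i) with hP
      have hmem : ∀ i ∈ P, i ≤ -2 := by
        intro i hi
        simp only [hP, hS', Finset.mem_filter, not_le] at hi
        have := hi.1.2; rw [abs_of_neg hi.2] at this; omega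
      set N : ℕ := P.sup (fun i : ℤ ↦ (-i - 1).toNat) with hN
      have hinj : Set.InjOn (fun i : ℤ ↦ (-i - 1).toNat) P := by
        intro i hi i' hi' h
        have h1 := hmem i hi; have h2 := hmem i' hi'
        simp only at h
        omega
      calc ∑ i ∈ P, (((|i| : ℤ) : ℝ) - 1)⁻¹ ^ 2
          = ∑ i ∈ P, (((((-i - 1).toNat : ℕ) : ℝ)) ^ 2)⁻¹ := by
            refine Finset.sum_congr rfl fun i hi ↦ ?_
            have h1 := hmem i hi
            rw [abs_of_neg (by omega), inv_pow]
            congr 2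
            have : ((-i - 1).toNat : ℤ) = -i - 1 := Int.toNat_of_nonneg (by omega)
            have : (((-i - 1).toNat : ℕ) : ℝ) = ((-i - 1 : ℤ) : ℝ) := by exact_mod_cast this
            rw [this]; push_cast; ring
        _ = ∑ n ∈ P.image (fun i : ℤ ↦ (-i - 1).toNat), ((n : ℝ) ^ 2)⁻¹ :=
            (Finset.sum_image (f := fun n : ℕ ↦ ((n : ℝ) ^ 2)⁻¹) hinj).symm
        _ ≤ ∑ n ∈ Finset.Icc 1 N, ((n : ℝ) ^ 2)⁻¹ := by
            refine Finset.sum_le_sum_of_subset_of_nonneg (fun n hn ↦ ?_) fun _ _ _ ↦ by positivity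
            simp only [Finset.mem_image] at hn
            obtain ⟨i, hi, rfl⟩ := hn
            have h1 := hmem i hi
            have hle : (-i - 1).toNat ≤ N := Finset.le_sup (f := fun i : ℤ ↦ (-i - 1).toNat) hi
            simp only [Finset.mem_Icc]
            constructor <;> omega
        _ ≤ 2 := sum_Icc_inv_sq_le_two N
    linarith
  linarith

/-- **Kernel sums over well-spaced points.** For a finite set `𝒯` of reals pairwise `≥ 1` apart,
`m > 0` and any real `x`: `∑_{t ∈ 𝒯} 1/(m² + (x - t)²) ≤ 3/m² + 4`. [folklore] -/
theorem sum_inv_sq_add_sq_le (𝒯 : Finset ℝ)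
    (hsep : ∀ t ∈ 𝒯, ∀ t' ∈ 𝒯, t ≠ t' → 1 ≤ |t - t'|) {m : ℝ} (hm : 0 < m) (x : ℝ) :
    ∑ t ∈ 𝒯, (m ^ 2 + (x - t) ^ 2)⁻¹ ≤ 3 * (m ^ 2)⁻¹ + 4 := by
  classical
  have hinj : Set.InjOn (fun t : ℝ ↦ ⌊t⌋ - ⌊x⌋) 𝒯 := by
    intro t ht t' ht' h
    exact injOn_floor_of_sep 𝒯 hsep ht ht' (by simpa using h)
  calc ∑ t ∈ 𝒯, (m ^ 2 + (x - t) ^ 2)⁻¹ ≤ ∑ t ∈ 𝒯, kernG m (⌊t⌋ - ⌊x⌋) :=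
        Finset.sum_le_sum fun t _ ↦ inv_sq_add_sq_le_kernG hm x t
    _ = ∑ i ∈ 𝒯.image (fun t : ℝ ↦ ⌊t⌋ - ⌊x⌋), kernG m i := (Finset.sum_image hinj).symm
    _ ≤ 3 * (m ^ 2)⁻¹ + 4 := sum_kernG_le hm _




/-- **Cauchy–Schwarz for interval integrals** of continuous functions, squared form:
`(∫_a^b f g)² ≤ (∫_a^b f²)(∫_a^b g²)` (`a ≤ b`) — from the tree's
`Literature.NumberTheory.LFunctions.Gallagher.integral_mul_le_sqrt_mul_sqrt` applied to `(f, g)` and `(-f, g)`. [folklore] -/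
theorem sq_integral_mul_le {a b : ℝ} (hab : a ≤ b) {f g : ℝ → ℝ} (hf : Continuous f)
    (hg : Continuous g) :
    (∫ x in a..b, f x * g x) ^ 2 ≤ (∫ x in a..b, f x ^ 2) * ∫ x in a..b, g x ^ 2 := by
  have h1 := Literature.NumberTheory.LFunctions.Gallagher.integral_mul_le_sqrt_mul_sqrt hab hf hg
  have h2 := Literature.NumberTheory.LFunctions.Gallagher.integral_mul_le_sqrt_mul_sqrt hab hf.neg hg
  have e1 : ∫ x in a..b, (-f) x * g x = -∫ x in a..b, f x * g x := by
    rw [← intervalIntegral.integral_neg]; exact integral_congr fun x _ ↦ by simp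
  have e2 : ∫ x in a..b, (-f) x ^ 2 = ∫ x in a..b, f x ^ 2 := integral_congr fun x _ ↦ by simp
  rw [e1, e2] at h2
  have hA : 0 ≤ ∫ x in a..b, f x ^ 2 := integral_nonneg hab fun x _ ↦ sq_nonneg _
  have hC : 0 ≤ ∫ x in a..b, g x ^ 2 := integral_nonneg hab fun x _ ↦ sq_nonneg _
  have habs : |∫ x in a..b, f x * g x| ≤ Real.sqrt (∫ x in a..b, f x ^ 2) * Real.sqrt (∫ x in a..b, g x ^ 2) :=
    abs_le.2 ⟨by linarith, h1⟩
  calc (∫ x in a..b, f x * g x) ^ 2 = |∫ x in a..b, f x * g x| ^ 2 := (sq_abs _).symm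
    _ ≤ (Real.sqrt (∫ x in a..b, f x ^ 2) * Real.sqrt (∫ x in a..b, g x ^ 2)) ^ 2 :=
        pow_le_pow_left₀ (abs_nonneg _) habs 2
    _ = (∫ x in a..b, f x ^ 2) * ∫ x in a..b, g x ^ 2 := by
        rw [mul_pow, Real.sq_sqrt hA, Real.sq_sqrt hC]

/-- **Hölder with exponents `(4, 2, 4)`**, fourth-power form, for continuous nonnegative functions:
`(∫_a^b F G H)⁴ ≤ (∫ F⁴)(∫ H⁴)(∫ G²)²`. [folklore] -/
theorem pow_four_integral_mul_mul_le {a b : ℝ} (hab : a ≤ b) {F G H : ℝ → ℝ} (hF : Continuous F)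
    (hG : Continuous G) (hH : Continuous H) :
    (∫ x in a..b, F x * G x * H x) ^ 4 ≤
      (∫ x in a..b, F x ^ 4) * (∫ x in a..b, H x ^ 4) * (∫ x in a..b, G x ^ 2) ^ 2 := by
  have h1 := sq_integral_mul_le hab (f := fun x ↦ F x * H x) (g := G) (by fun_prop) hG
  have h2 := sq_integral_mul_le hab (f := fun x ↦ F x ^ 2) (g := fun x ↦ H x ^ 2) (by fun_prop)
    (by fun_prop)
  have e1 : ∫ x in a..b, F x * G x * H x = ∫ x in a..b, F x * H x * G x :=
    integral_congr fun x _ ↦ by ring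
  have e2 : ∫ x in a..b, (F x * H x) ^ 2 = ∫ x in a..b, F x ^ 2 * H x ^ 2 :=
    integral_congr fun x _ ↦ by ring
  have e3 : ∫ x in a..b, (F x ^ 2) ^ 2 = ∫ x in a..b, F x ^ 4 :=
    integral_congr fun x _ ↦ by ring
  have e4 : ∫ x in a..b, (H x ^ 2) ^ 2 = ∫ x in a..b, H x ^ 4 :=
    integral_congr fun x _ ↦ by ring
  rw [e2] at h1
  rw [e3, e4] at h2
  rw [e1]
  have hG2 : 0 ≤ ∫ x in a..b, G x ^ 2 := integral_nonneg hab fun x _ ↦ sq_nonneg _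
  have hFH : 0 ≤ ∫ x in a..b, F x ^ 2 * H x ^ 2 := integral_nonneg hab fun x _ ↦ by positivity
  calc (∫ x in a..b, F x * H x * G x) ^ 4 = ((∫ x in a..b, F x * H x * G x) ^ 2) ^ 2 := by ring
    _ ≤ ((∫ x in a..b, F x ^ 2 * H x ^ 2) * ∫ x in a..b, G x ^ 2) ^ 2 :=
        pow_le_pow_left₀ (sq_nonneg _) h1 2
    _ = (∫ x in a..b, F x ^ 2 * H x ^ 2) ^ 2 * (∫ x in a..b, G x ^ 2) ^ 2 := by ring
    _ ≤ ((∫ x in a..b, F x ^ 4) * ∫ x in a..b, H x ^ 4) * (∫ x in a..b, G x ^ 2) ^ 2 :=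
        mul_le_mul_of_nonneg_right h2 (sq_nonneg _)

/-- **Discrete Hölder `(4, 2, 4)`**, fourth-power form: for nonnegative `a_r, b_r`,
`(∑_r a_r^{1/4} b_r^{1/2})⁴ ≤ |R| (∑ a_r)(∑ b_r)²`. [folklore] -/
theorem pow_four_sum_sqrt_sqrt_mul_sqrt_le {ι : Type*} (s : Finset ι) {a b : ι → ℝ}
    (ha : ∀ i ∈ s, 0 ≤ a i) (hb : ∀ i ∈ s, 0 ≤ b i) :
    (∑ i ∈ s, Real.sqrt (Real.sqrt (a i)) * Real.sqrt (b i)) ^ 4 ≤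
      s.card * (∑ i ∈ s, a i) * (∑ i ∈ s, b i) ^ 2 := by
  have h1 := Finset.sum_mul_sq_le_sq_mul_sq s (fun i ↦ Real.sqrt (Real.sqrt (a i)))
    (fun i ↦ Real.sqrt (b i))
  have h2 := Finset.sum_mul_sq_le_sq_mul_sq s (fun i ↦ Real.sqrt (a i)) (fun _ ↦ (1 : ℝ))
  have e1 : ∑ i ∈ s, Real.sqrt (Real.sqrt (a i)) ^ 2 = ∑ i ∈ s, Real.sqrt (a i) :=
    Finset.sum_congr rfl fun i _ ↦ Real.sq_sqrt (Real.sqrt_nonneg _)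
  have e2 : ∑ i ∈ s, Real.sqrt (b i) ^ 2 = ∑ i ∈ s, b i :=
    Finset.sum_congr rfl fun i hi ↦ Real.sq_sqrt (hb i hi)
  have e3 : ∑ i ∈ s, Real.sqrt (a i) ^ 2 = ∑ i ∈ s, a i :=
    Finset.sum_congr rfl fun i hi ↦ Real.sq_sqrt (ha i hi)
  rw [e1, e2] at h1
  simp only [mul_one, one_pow, Finset.sum_const, nsmul_eq_mul, e3] at h2
  have hsa : 0 ≤ ∑ i ∈ s, Real.sqrt (a i) := Finset.sum_nonneg fun i _ ↦ Real.sqrt_nonneg _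
  have hsb : 0 ≤ ∑ i ∈ s, b i := Finset.sum_nonneg hb
  calc (∑ i ∈ s, Real.sqrt (Real.sqrt (a i)) * Real.sqrt (b i)) ^ 4
      = ((∑ i ∈ s, Real.sqrt (Real.sqrt (a i)) * Real.sqrt (b i)) ^ 2) ^ 2 := by ring
    _ ≤ ((∑ i ∈ s, Real.sqrt (a i)) * ∑ i ∈ s, b i) ^ 2 := pow_le_pow_left₀ (sq_nonneg _) h1 2
    _ = (∑ i ∈ s, Real.sqrt (a i)) ^ 2 * (∑ i ∈ s, b i) ^ 2 := by ring
    _ ≤ ((∑ i ∈ s, a i) * s.card) * (∑ i ∈ s, b i) ^ 2 :=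
        mul_le_mul_of_nonneg_right h2 (sq_nonneg _)
    _ = _ := by ring




/-! ### Discrete Abel summation over a block `(M, K]` -/

/-- Abel summation over `M < n ≤ K`: with `S(u) = ∑_{M<n≤u} c_n`,
`∑_{M<n≤K} c_n w_n = S(K) w_K + ∑_{M<u<K} S(u) (w_u - w_{u+1})`. [folklore] -/
theorem sum_Ioc_mul_eq_abel (c w : ℕ → ℂ) (M : ℕ) {K : ℕ} (hK : M ≤ K) :
    ∑ n ∈ Finset.Ioc M K, c n * w n =
      (∑ n ∈ Finset.Ioc M K, c n) * w K + ∑ u ∈ Finset.Ioo M K, (∑ n ∈ Finset.Ioc M u, c n) * (w u - w (u + 1)) := by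
  induction K, hK using Nat.le_induction with
  | base => simp
  | succ K hMK ih =>
    rw [Finset.sum_Ioc_succ_top (by omega), ih, Finset.sum_Ioc_succ_top (by omega)]
    rcases Nat.lt_or_ge M K with hlt | hge
    · have e : Finset.Ioo M (K + 1) = insert K (Finset.Ioo M K) := by
        ext u; simp; omega
      rw [e, Finset.sum_insert (by simp)]
      ring
    · have hKM : K = M := by omega
      subst hKM
      have e : Finset.Ioo K (K + 1) = ∅ := by ext u; simp
      simp [e]

/-- The norm form of Abel summation with real weights `0 ≤ w_{u+1} ≤ w_u ≤ 1`:
`‖∑_{M<n≤K} c_n w_n‖ ≤ ‖S(K)‖ + ∑_{M<u<K} ‖S(u)‖ (w_u - w_{u+1})`. [folklore] -/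
theorem norm_sum_Ioc_mul_le_abel (c : ℕ → ℂ) (w : ℕ → ℝ) (M : ℕ) {K : ℕ} (hK : M ≤ K)
    (hw1 : w K ≤ 1) (hw0 : 0 ≤ w K) (hmono : ∀ u ∈ Finset.Ioo M K, w (u + 1) ≤ w u) :
    ‖∑ n ∈ Finset.Ioc M K, c n * (w n : ℂ)‖ ≤
      ‖∑ n ∈ Finset.Ioc M K, c n‖ + ∑ u ∈ Finset.Ioo M K, ‖∑ n ∈ Finset.Ioc M u, c n‖ * (w u - w (u + 1)) := by
  rw [sum_Ioc_mul_eq_abel c (fun n ↦ (w n : ℂ)) M hK]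
  refine (norm_add_le _ _).trans (add_le_add ?_ ?_)
  · rw [norm_mul, Complex.norm_real, Real.norm_of_nonneg hw0]
    exact mul_le_of_le_one_right (norm_nonneg _) hw1
  · refine (norm_sum_le _ _).trans (Finset.sum_le_sum fun u hu ↦ ?_)
    rw [norm_mul, ← Complex.ofReal_sub, Complex.norm_real,
      Real.norm_of_nonneg (sub_nonneg.2 (hmono u hu))]

/-- For `0 ≤ δ ≤ 1/2` and `u ≥ 1`: `u^{-δ} - (u+1)^{-δ} ≤ 1/(2u)` (Bernoulli's inequality).
[folklore] -/
theorem rpow_neg_sub_rpow_neg_succ_le {δ : ℝ} (hδ0 : 0 ≤ δ) (hδ1 : δ ≤ 1 / 2) {u : ℝ} (hu : 1 ≤ u) :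
    u ^ (-δ) - (u + 1) ^ (-δ) ≤ 1 / (2 * u) := by
  have hu0 : 0 < u := by linarith
  -- `(1 + 1/u)^δ ≤ 1 + δ/u`
  have hB : (1 + 1 / u) ^ δ ≤ 1 + δ * (1 / u) :=
    rpow_one_add_le_one_add_mul_self (by linarith [(by positivity : (0:ℝ) ≤ 1 / u)]) hδ0 (by linarith)
  have hpos : 0 < (1 + 1 / u) ^ δ := Real.rpow_pos_of_pos (by positivity) _
  have h1 : (u + 1) ^ (-δ) = u ^ (-δ) * ((1 + 1 / u) ^ δ)⁻¹ := by
    rw [show u + 1 = u * (1 + 1 / u) by field_simp, Real.mul_rpow hu0.le (by positivity),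
      Real.rpow_neg (by positivity : (0 : ℝ) ≤ 1 + 1 / u)]
  have hule : u ^ (-δ) ≤ 1 := Real.rpow_le_one_of_one_le_of_nonpos hu (by linarith)
  have hu0' : 0 ≤ u ^ (-δ) := Real.rpow_nonneg hu0.le _
  rw [h1, ← mul_one_sub]
  set A := (1 + 1 / u) ^ δ with hA
  have hA1 : 1 ≤ A := Real.one_le_rpow (by simp only [le_add_iff_nonneg_right]; positivity) hδ0
  have hA0 : 0 < A := by linarith
  have hkey : 1 - A⁻¹ ≤ A - 1 := by
    rw [show 1 - A⁻¹ = (A - 1) / A by field_simp]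
    exact div_le_self (by linarith) hA1
  have h3 : 1 - A⁻¹ ≤ 1 / (2 * u) := by
    calc 1 - A⁻¹ ≤ A - 1 := hkey
      _ ≤ δ * (1 / u) := by linarith
      _ = δ / u := by ring
      _ ≤ (1 / 2) / u := div_le_div_of_nonneg_right hδ1 hu0.le
      _ = 1 / (2 * u) := by field_simp
  have h4 : 0 ≤ 1 - A⁻¹ := sub_nonneg.2 (inv_le_one_of_one_le₀ hA1)
  calc u ^ (-δ) * (1 - A⁻¹) ≤ 1 * (1 / (2 * u)) := mul_le_mul hule h3 h4 zero_le_one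
    _ = 1 / (2 * u) := one_mul _

/-! ### The Class-I count -/

/-- `n^{-ρ} = n^{-σ} · n^{-iγ} · n^{-(β-σ)}` for `ρ = β + iγ`, `n ≥ 1`. [folklore] -/
theorem natCast_cpow_neg_eq (n : ℕ) (hn : n ≠ 0) (ρ : ℂ) (σ : ℝ) :
    (n : ℂ) ^ (-ρ) = (((n : ℝ) ^ (-σ) : ℝ) : ℂ) * (n : ℂ) ^ (-(ρ.im * I)) *
      (((n : ℝ) ^ (-(ρ.re - σ)) : ℝ) : ℂ) := by
  have hn0 : (n : ℂ) ≠ 0 := by exact_mod_cast hn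
  have hn' : (0 : ℝ) ≤ n := Nat.cast_nonneg n
  rw [Complex.ofReal_cpow hn', Complex.ofReal_cpow hn', Complex.ofReal_natCast, ← Complex.cpow_add _ _ hn0,
    ← Complex.cpow_add _ _ hn0]
  congr 1
  apply Complex.ext
  · simp; ring
  · simp

/-- `(x^{-σ})² = x^{-2σ}` for `x ≥ 0`. [folklore] -/
theorem rpow_neg_sq {x : ℝ} (hx : 0 ≤ x) (σ : ℝ) : (x ^ (-σ)) ^ 2 = x ^ (-2 * σ) := by
  rw [← Real.rpow_natCast, ← Real.rpow_mul hx]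
  congr 1
  push_cast
  ring

/-- **The Class-I count** (Ivić 1985, §11.2–§11.3, the bound for `R₁` in the proof of (11.22),
via (11.18) with `α = 2` and the discrete mean value theorem (5.14)). Let `M ≥ 1`, `T ≥ 1`,
`V > 0`, and let `Z` be a finite set of points `ρ = β + iγ` with `σ ≤ β ≤ σ + 1/2`, `|γ| ≤ T`,
ordinates pairwise `≥ 1` apart, each satisfying `|∑_{M<n≤2M} b(n) n^{-ρ}| ≥ V`. Then
`|Z| ≤ C₀ (T + 2M) log(4M) (∑_{M<n≤2M} |b(n)|² n^{-2σ}) / V²` with an absolute `C₀`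
(the factor `n^{-(β-σ)}` is removed by Abel summation, the partial sums being estimated uniformly
by the discrete mean value theorem and Cauchy's inequality). [cite: Ivic1985, §11.3 proof of (11.22), bound for R₁] -/
theorem exists_classOne_const : ∃ C₀ : ℝ, 0 ≤ C₀ ∧
    ∀ (b : ℕ → ℂ) (M : ℕ) (σ T V : ℝ) (Z : Finset ℂ), 1 ≤ M → 1 ≤ T → 0 < V →
      (∀ ρ ∈ Z, σ ≤ ρ.re ∧ ρ.re ≤ σ + 1 / 2) → (∀ ρ ∈ Z, |ρ.im| ≤ T) →
      (∀ ρ ∈ Z, ∀ ρ' ∈ Z, ρ ≠ ρ' → 1 ≤ |ρ.im - ρ'.im|) →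
      (∀ ρ ∈ Z, V ≤ ‖∑ n ∈ Finset.Ioc M (2 * M), b n * (n : ℂ) ^ (-ρ)‖) →
      (Z.card : ℝ) ≤ C₀ * (T + 2 * M) * Real.log (4 * M) *
        (∑ n ∈ Finset.Ioc M (2 * M), ‖b n‖ ^ 2 * (n : ℝ) ^ (-2 * σ)) / V ^ 2 := by
  obtain ⟨C, hC⟩ := MatomakiRadziwill2016_lemma7_holds
  set C' := max C 0 with hC'
  refine ⟨9 / 4 * C', by positivity, ?_⟩
  intro b M σ T V Z hM hT hV hre him hsep hlarge
  classical
  -- notation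
  set B : ℝ := ∑ n ∈ Finset.Ioc M (2 * M), ‖b n‖ ^ 2 * (n : ℝ) ^ (-2 * σ) with hB
  have hB0 : 0 ≤ B := Finset.sum_nonneg fun n _ ↦ by positivity
  set L : ℝ := Real.log (4 * M) with hL
  have hL0 : 0 ≤ L := Real.log_nonneg (by norm_cast; omega)
  -- the coefficients `a_u(n) = b(n) n^{-σ}` on `M < n ≤ u`
  set a : ℕ → ℕ → ℂ := fun u n ↦ if M < n ∧ n ≤ u then b n * (((n : ℝ) ^ (-σ) : ℝ) : ℂ) else 0
    with ha
  -- partial sums `S_u(t)`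
  set S : ℕ → ℝ → ℂ := fun u t ↦ ∑ n ∈ Finset.Icc 1 (2 * M), a u n * (n : ℂ) ^ (-((t : ℂ) * I)) with hS
  have hS_eq : ∀ u, u ≤ 2 * M → ∀ t : ℝ, S u t =
      ∑ n ∈ Finset.Ioc M u, b n * (((n : ℝ) ^ (-σ) : ℝ) : ℂ) * (n : ℂ) ^ (-((t : ℂ) * I)) := by
    intro u hu t
    simp only [hS, ha]
    rw [← Finset.sum_filter_add_sum_filter_not (Finset.Icc 1 (2 * M)) (fun n ↦ M < n ∧ n ≤ u)]
    have e : (Finset.Icc 1 (2 * M)).filter (fun n ↦ M < n ∧ n ≤ u) = Finset.Ioc M u := by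
      ext n; simp; omega
    rw [e]
    have h0 : ∑ n ∈ (Finset.Icc 1 (2 * M)).filter (fun n ↦ ¬ (M < n ∧ n ≤ u)),
        (if M < n ∧ n ≤ u then b n * (((n : ℝ) ^ (-σ) : ℝ) : ℂ) else 0) * (n : ℂ) ^ (-((t : ℂ) * I)) = 0 :=
      Finset.sum_eq_zero fun n hn ↦ by
        simp only [Finset.mem_filter] at hn; simp [hn.2]
    rw [h0, add_zero]
    refine Finset.sum_congr rfl fun n hn ↦ ?_
    simp only [Finset.mem_Ioc] at hn
    simp [hn]
  -- Step 1: discrete MVT for each `u`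
  have hMVT : ∀ u, u ≤ 2 * M → ∑ ρ ∈ Z, ‖S u ρ.im‖ ^ 2 ≤ C' * (T + 2 * M) * L * B := by
    intro u hu
    have hinj : Set.InjOn Complex.im Z := by
      intro ρ hρ ρ' hρ' h
      by_contra hne
      have := hsep ρ hρ ρ' hρ' hne
      rw [h, sub_self, abs_zero] at this
      linarith
    rw [← Finset.sum_image (f := fun t : ℝ ↦ ‖S u t‖ ^ 2) hinj]
    have h1 := hC (2 * M) (a u) T (Z.image Complex.im) (by omega) hT
      (fun t ht ↦ by
        simp only [Finset.mem_image] at ht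
        obtain ⟨ρ, hρ, rfl⟩ := ht
        exact him ρ hρ)
      (fun t ht t' ht' hne ↦ by
        simp only [Finset.mem_image] at ht ht'
        obtain ⟨ρ, hρ, rfl⟩ := ht
        obtain ⟨ρ', hρ', rfl⟩ := ht'
        exact hsep ρ hρ ρ' hρ' fun h ↦ hne (by rw [h]))
    have hsuma : ∑ n ∈ Finset.Icc 1 (2 * M), ‖a u n‖ ^ 2 ≤ B := by
      calc ∑ n ∈ Finset.Icc 1 (2 * M), ‖a u n‖ ^ 2
          ≤ ∑ n ∈ Finset.Icc 1 (2 * M), (if M < n then ‖b n‖ ^ 2 * (n : ℝ) ^ (-2 * σ) else 0) := by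
            refine Finset.sum_le_sum fun n hn ↦ ?_
            simp only [ha]
            by_cases h : M < n ∧ n ≤ u
            · rw [if_pos h, if_pos h.1, norm_mul, mul_pow, Complex.norm_real,
                Real.norm_of_nonneg (Real.rpow_nonneg (Nat.cast_nonneg n) _),
                rpow_neg_sq (Nat.cast_nonneg n)]
            · rw [if_neg h, norm_zero]
              split_ifs
              · simp only [ne_eq, OfNat.ofNat_ne_zero, not_false_eq_true, zero_pow]
                positivity
              · simp
        _ = ∑ n ∈ (Finset.Icc 1 (2 * M)).filter (fun n ↦ M < n), ‖b n‖ ^ 2 * (n : ℝ) ^ (-2 * σ) :=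
            (Finset.sum_filter _ _).symm
        _ = B := by
            rw [hB]
            congr 1
            ext n; simp; omega
    have hlog : Real.log (2 * ((2 * M : ℕ) : ℝ)) = L := by
      rw [hL]; push_cast; ring_nf
    have hX0 : 0 ≤ (T + ((2 * M : ℕ) : ℝ)) * Real.log (2 * ((2 * M : ℕ) : ℝ)) *
        ∑ n ∈ Finset.Icc 1 (2 * M), ‖a u n‖ ^ 2 := by
      rw [hlog]; push_cast
      exact mul_nonneg (mul_nonneg (by positivity) hL0) (Finset.sum_nonneg fun _ _ ↦ by positivity)
    calc ∑ x ∈ Z.image Complex.im, ‖S u x‖ ^ 2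
        ≤ C * (T + ((2 * M : ℕ) : ℝ)) * Real.log (2 * ((2 * M : ℕ) : ℝ)) *
            ∑ n ∈ Finset.Icc 1 (2 * M), ‖a u n‖ ^ 2 := h1
      _ ≤ C' * (T + ((2 * M : ℕ) : ℝ)) * Real.log (2 * ((2 * M : ℕ) : ℝ)) *
            ∑ n ∈ Finset.Icc 1 (2 * M), ‖a u n‖ ^ 2 := by
          have e : ∀ K : ℝ, K * (T + ((2 * M : ℕ) : ℝ)) * Real.log (2 * ((2 * M : ℕ) : ℝ)) *
              ∑ n ∈ Finset.Icc 1 (2 * M), ‖a u n‖ ^ 2 = K * ((T + ((2 * M : ℕ) : ℝ)) *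
                Real.log (2 * ((2 * M : ℕ) : ℝ)) * ∑ n ∈ Finset.Icc 1 (2 * M), ‖a u n‖ ^ 2) := by
            intro K; ring
          rw [e, e]
          exact mul_le_mul_of_nonneg_right (le_max_left _ _) hX0
      _ = C' * (T + 2 * M) * L * ∑ n ∈ Finset.Icc 1 (2 * M), ‖a u n‖ ^ 2 := by
          rw [hlog]; push_cast; ring
      _ ≤ C' * (T + 2 * M) * L * B := by
          refine mul_le_mul_of_nonneg_left hsuma ?_
          exact mul_nonneg (mul_nonneg (le_max_right _ _) (by positivity)) hL0
  -- Step 2: Abel summation for each `ρ`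
  have hAbel : ∀ ρ ∈ Z, ‖∑ n ∈ Finset.Ioc M (2 * M), b n * (n : ℂ) ^ (-ρ)‖ ≤
      ‖S (2 * M) ρ.im‖ + ∑ u ∈ Finset.Ioo M (2 * M), ‖S u ρ.im‖ * (1 / (2 * (u : ℝ))) := by
    intro ρ hρ
    set δ : ℝ := ρ.re - σ with hδ
    have hδ0 : 0 ≤ δ := by rw [hδ]; linarith [(hre ρ hρ).1]
    have hδ1 : δ ≤ 1 / 2 := by rw [hδ]; linarith [(hre ρ hρ).2]
    set c : ℕ → ℂ := fun n ↦ b n * (((n : ℝ) ^ (-σ) : ℝ) : ℂ) * (n : ℂ) ^ (-((ρ.im : ℂ) * I))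
      with hc
    set w : ℕ → ℝ := fun n ↦ (n : ℝ) ^ (-δ) with hw
    have hD : ∑ n ∈ Finset.Ioc M (2 * M), b n * (n : ℂ) ^ (-ρ) = ∑ n ∈ Finset.Ioc M (2 * M), c n * (w n : ℂ) := by
      refine Finset.sum_congr rfl fun n hn ↦ ?_
      simp only [Finset.mem_Ioc] at hn
      rw [natCast_cpow_neg_eq n (by omega) ρ σ, hc, hw, hδ]
      ring
    have hSc : ∀ u, u ≤ 2 * M → ∑ n ∈ Finset.Ioc M u, c n = S u ρ.im := fun u hu ↦ (hS_eq u hu ρ.im).symm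
    rw [hD]
    have hM2 : (1 : ℝ) ≤ ((2 * M : ℕ) : ℝ) := by exact_mod_cast (by omega : 1 ≤ 2 * M)
    have hw1 : w (2 * M) ≤ 1 := Real.rpow_le_one_of_one_le_of_nonpos hM2 (by linarith)
    have hw0 : 0 ≤ w (2 * M) := Real.rpow_nonneg (by positivity) _
    have hmono : ∀ u ∈ Finset.Ioo M (2 * M), w (u + 1) ≤ w u := by
      intro u hu
      simp only [Finset.mem_Ioo] at hu
      have hu0 : (0 : ℝ) < u := by exact_mod_cast (by omega : 0 < u)
      simp only [hw]
      push_cast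
      exact Real.rpow_le_rpow_of_nonpos hu0 (by linarith) (by linarith)
    refine (norm_sum_Ioc_mul_le_abel c w M (by omega) hw1 hw0 hmono).trans ?_
    rw [hSc (2 * M) le_rfl]
    refine add_le_add le_rfl (Finset.sum_le_sum fun u hu ↦ ?_)
    simp only [Finset.mem_Ioo] at hu
    rw [hSc u (by omega)]
    refine mul_le_mul_of_nonneg_left ?_ (norm_nonneg _)
    have hu1 : (1 : ℝ) ≤ u := by exact_mod_cast (by omega : 1 ≤ u)
    have := rpow_neg_sub_rpow_neg_succ_le hδ0 hδ1 hu1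
    simp only [hw]
    push_cast
    exact this
  -- Step 3: sum over `Z`, Cauchy–Schwarz, and the uniform bound of Step 1
  set Q : ℝ := Real.sqrt (Z.card * (C' * (T + 2 * M) * L * B)) with hQ
  have hQ0 : 0 ≤ Q := Real.sqrt_nonneg _
  have hCS : ∀ u, u ≤ 2 * M → ∑ ρ ∈ Z, ‖S u ρ.im‖ ≤ Q := by
    intro u hu
    have h1 := sq_sum_le_card_mul_sum_sq (s := Z) (f := fun ρ ↦ ‖S u ρ.im‖)
    have h2 : (∑ ρ ∈ Z, ‖S u ρ.im‖) ^ 2 ≤ Z.card * (C' * (T + 2 * M) * L * B) :=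
      h1.trans (mul_le_mul_of_nonneg_left (hMVT u hu) (Nat.cast_nonneg _))
    rw [hQ]
    exact (Real.le_sqrt (Finset.sum_nonneg fun _ _ ↦ norm_nonneg _) (by positivity)).2 h2
  have hsum_inv : ∑ u ∈ Finset.Ioo M (2 * M), (1 / (2 * (u : ℝ))) ≤ 1 / 2 := by
    have h1 : ∀ u ∈ Finset.Ioo M (2 * M), (1 / (2 * (u : ℝ))) ≤ 1 / (2 * ((M : ℝ) + 1)) := by
      intro u hu
      simp only [Finset.mem_Ioo] at hu
      have : (M : ℝ) + 1 ≤ u := by exact_mod_cast (by omega : M + 1 ≤ u)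
      exact one_div_le_one_div_of_le (by positivity) (by linarith)
    refine (Finset.sum_le_sum h1).trans ?_
    rw [Finset.sum_const, nsmul_eq_mul, Nat.card_Ioo]
    have hM' : ((2 * M - M - 1 : ℕ) : ℝ) ≤ (M : ℝ) + 1 := by
      have : 2 * M - M - 1 ≤ M + 1 := by omega
      exact_mod_cast this
    have hM1 : (0 : ℝ) < (M : ℝ) + 1 := by positivity
    calc ((2 * M - M - 1 : ℕ) : ℝ) * (1 / (2 * ((M : ℝ) + 1)))
        ≤ ((M : ℝ) + 1) * (1 / (2 * ((M : ℝ) + 1))) :=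
          mul_le_mul_of_nonneg_right hM' (by positivity)
      _ = 1 / 2 := by field_simp
  have hmain : V * Z.card ≤ 3 / 2 * Q := by
    calc V * Z.card = ∑ ρ ∈ Z, V := by rw [Finset.sum_const, nsmul_eq_mul, mul_comm]
      _ ≤ ∑ ρ ∈ Z, ‖∑ n ∈ Finset.Ioc M (2 * M), b n * (n : ℂ) ^ (-ρ)‖ := Finset.sum_le_sum hlarge
      _ ≤ ∑ ρ ∈ Z, (‖S (2 * M) ρ.im‖ + ∑ u ∈ Finset.Ioo M (2 * M), ‖S u ρ.im‖ * (1 / (2 * (u : ℝ)))) :=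
          Finset.sum_le_sum hAbel
      _ = ∑ ρ ∈ Z, ‖S (2 * M) ρ.im‖ +
            ∑ u ∈ Finset.Ioo M (2 * M), (1 / (2 * (u : ℝ))) * ∑ ρ ∈ Z, ‖S u ρ.im‖ := by
          rw [Finset.sum_add_distrib, Finset.sum_comm]
          congr 1
          refine Finset.sum_congr rfl fun u _ ↦ ?_
          rw [Finset.mul_sum]
          refine Finset.sum_congr rfl fun ρ _ ↦ by ring
      _ ≤ Q + ∑ u ∈ Finset.Ioo M (2 * M), (1 / (2 * (u : ℝ))) * Q := by
          refine add_le_add (hCS (2 * M) le_rfl) (Finset.sum_le_sum fun u hu ↦ ?_)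
          simp only [Finset.mem_Ioo] at hu
          exact mul_le_mul_of_nonneg_left (hCS u (by omega)) (by positivity)
      _ = Q * (1 + ∑ u ∈ Finset.Ioo M (2 * M), (1 / (2 * (u : ℝ)))) := by
          rw [← Finset.sum_mul]; ring
      _ ≤ Q * (1 + 1 / 2) := mul_le_mul_of_nonneg_left (by linarith) hQ0
      _ = 3 / 2 * Q := by ring
  -- conclude
  have hK0 : 0 ≤ C' * (T + 2 * M) * L * B :=
    mul_nonneg (mul_nonneg (mul_nonneg (le_max_right _ _) (by positivity)) hL0) hB0
  have hsq : (V * Z.card) ^ 2 ≤ 9 / 4 * (Z.card * (C' * (T + 2 * M) * L * B)) := by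
    have h := pow_le_pow_left₀ (by positivity) hmain 2
    have e : (3 / 2 * Q) ^ 2 = 9 / 4 * (Z.card * (C' * (T + 2 * M) * L * B)) := by
      rw [mul_pow, hQ, Real.sq_sqrt (by positivity)]; ring
    linarith
  rcases Nat.eq_zero_or_pos Z.card with hZ | hZ
  · rw [hZ]; simp only [Nat.cast_zero]; positivity
  · have hZ' : (0 : ℝ) < Z.card := by exact_mod_cast hZ
    rw [le_div_iff₀ (by positivity)]
    have : (Z.card : ℝ) * V ^ 2 * Z.card ≤ 9 / 4 * C' * (T + 2 * ↑M) * L * B * Z.card := by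
      nlinarith
    exact le_of_mul_le_mul_right this hZ'






/-! ### The Riesz kernel on the lines `Re w = -η` -/


/-- `‖K(-η + iy)‖ ≤ 2/(η₀(η₀² + y²))` for `η₀ ≤ η ≤ 1/2`, `η₀ > 0`. [folklore] -/
theorem norm_rieszK_neg_line_le {η₀ η : ℝ} (hη₀ : 0 < η₀) (h1 : η₀ ≤ η) (h2 : η ≤ 1 / 2) (y : ℝ) :
    ‖ZeroDetect.rieszK (((-η : ℝ) : ℂ) + y * I)‖ ≤ 2 / (η₀ * (η₀ ^ 2 + y ^ 2)) := by
  have h := Literature.NumberTheory.LFunctions.RieszPerron.norm_Kfun_le (σ := -η) hη₀ (by rw [abs_neg, abs_of_pos (by linarith)]; exact h1)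
    (by rw [abs_of_pos (by linarith)]; linarith) (by rw [abs_of_pos (by linarith)]; linarith) y
  simpa [ZeroDetect.rieszK] using h

/-- Continuity of `y ↦ ‖K(-η + iy)‖` for `0 < η ≤ 1/2`. [folklore] -/
theorem continuous_norm_rieszK_neg_line {η : ℝ} (h0 : 0 < η) (h2 : η ≤ 1 / 2) :
    Continuous fun y : ℝ ↦ ‖ZeroDetect.rieszK (((-η : ℝ) : ℂ) + y * I)‖ := by
  have h := Literature.NumberTheory.LFunctions.RieszPerron.continuous_Kfun_line (σ := -η) (by linarith) (by linarith) (by linarith)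
  simpa [ZeroDetect.rieszK] using h.norm

/-- `∫_{-T}^{T} ‖K(-η+iy)‖ dy ≤ 2π/η₀²` for `η₀ ≤ η ≤ 1/2`. [folklore] -/
theorem integral_norm_rieszK_le {η₀ η : ℝ} (hη₀ : 0 < η₀) (h1 : η₀ ≤ η) (h2 : η ≤ 1 / 2) {T : ℝ}
    (hT : 0 ≤ T) :
    ∫ y in (-T)..T, ‖ZeroDetect.rieszK (((-η : ℝ) : ℂ) + y * I)‖ ≤ 2 * π / η₀ ^ 2 := by
  have hT' : -T ≤ T := by linarith
  calc ∫ y in (-T)..T, ‖ZeroDetect.rieszK (((-η : ℝ) : ℂ) + y * I)‖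
      ≤ ∫ y in (-T)..T, 2 / (η₀ * (η₀ ^ 2 + y ^ 2)) := by
        refine integral_mono_on hT' ((continuous_norm_rieszK_neg_line (by linarith) h2).intervalIntegrable _ _) ?_
          fun y _ ↦ norm_rieszK_neg_line_le hη₀ h1 h2 y
        refine Continuous.intervalIntegrable ?_ _ _
        refine Continuous.div continuous_const (by fun_prop) fun y ↦ by positivity
    _ = 2 / η₀ * ∫ y in (-T)..T, (η₀ ^ 2 + y ^ 2)⁻¹ := by
        rw [← intervalIntegral.integral_const_mul]
        refine integral_congr fun y _ ↦ ?_
        field_simp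
    _ = 2 / η₀ * (η₀⁻¹ * (Real.arctan (T / η₀) - Real.arctan (-T / η₀))) := by
        rw [integral_inv_sq_add_sq hη₀.ne']
    _ ≤ 2 / η₀ * (η₀⁻¹ * π) := by
        refine mul_le_mul_of_nonneg_left (mul_le_mul_of_nonneg_left ?_ (by positivity)) (by positivity)
        have h1 := Real.arctan_lt_pi_div_two (T / η₀)
        have h2 := Real.neg_pi_div_two_lt_arctan (-T / η₀)
        linarith
    _ = 2 * π / η₀ ^ 2 := by field_simp

/-- Kernel sums over `1`-spaced ordinates: `∑_ρ ‖K(-η_ρ + i(t - γ_ρ))‖ ≤ (2/η₀)(3/η₀² + 4)`.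
[folklore] -/
theorem sum_norm_rieszK_le {η₀ : ℝ} (hη₀ : 0 < η₀) (Z : Finset ℂ)
    (hη : ∀ ρ ∈ Z, η₀ ≤ ρ.re - 1 / 2 ∧ ρ.re - 1 / 2 ≤ 1 / 2)
    (hsep : ∀ ρ ∈ Z, ∀ ρ' ∈ Z, ρ ≠ ρ' → 1 ≤ |ρ.im - ρ'.im|) (t : ℝ) :
    ∑ ρ ∈ Z, ‖ZeroDetect.rieszK (((1 / 2 - ρ.re : ℝ) : ℂ) + (t - ρ.im : ℝ) * I)‖ ≤
      2 / η₀ * (3 * (η₀ ^ 2)⁻¹ + 4) := by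
  classical
  have hinj : Set.InjOn Complex.im Z := by
    intro ρ hρ ρ' hρ' h
    by_contra hne
    have := hsep ρ hρ ρ' hρ' hne
    rw [h, sub_self, abs_zero] at this
    linarith
  calc ∑ ρ ∈ Z, ‖ZeroDetect.rieszK (((1 / 2 - ρ.re : ℝ) : ℂ) + (t - ρ.im : ℝ) * I)‖
      ≤ ∑ ρ ∈ Z, 2 / (η₀ * (η₀ ^ 2 + (t - ρ.im) ^ 2)) :=
        Finset.sum_le_sum fun ρ hρ ↦ by
          rw [show (1 / 2 - ρ.re : ℝ) = -(ρ.re - 1 / 2) by ring]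
          exact norm_rieszK_neg_line_le hη₀ (hη ρ hρ).1 (hη ρ hρ).2 _
    _ = 2 / η₀ * ∑ ρ ∈ Z, (η₀ ^ 2 + (t - ρ.im) ^ 2)⁻¹ := by
        rw [Finset.mul_sum]
        refine Finset.sum_congr rfl fun ρ _ ↦ ?_
        field_simp
    _ = 2 / η₀ * ∑ γ ∈ Z.image Complex.im, (η₀ ^ 2 + (t - γ) ^ 2)⁻¹ := by
        rw [Finset.sum_image (f := fun γ : ℝ ↦ (η₀ ^ 2 + (t - γ) ^ 2)⁻¹) hinj]
    _ ≤ 2 / η₀ * (3 * (η₀ ^ 2)⁻¹ + 4) := by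
        refine mul_le_mul_of_nonneg_left (sum_inv_sq_add_sq_le _ ?_ hη₀ t) (by positivity)
        intro γ hγ γ' hγ' hne
        simp only [Finset.mem_image] at hγ hγ'
        obtain ⟨ρ, hρ, rfl⟩ := hγ
        obtain ⟨ρ', hρ', rfl⟩ := hγ'
        exact hsep ρ hρ ρ' hρ' fun h ↦ hne (by rw [h])

/-! ### The Class-II count -/

/-- `(√(√k))⁴ = k`, `√(√k)·√k·√(√k) = k` bookkeeping. [folklore] -/
theorem sqrt_sqrt_pow_four {k : ℝ} (hk : 0 ≤ k) : Real.sqrt (Real.sqrt k) ^ 4 = k := by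
  rw [show (4 : ℕ) = 2 * 2 by norm_num, pow_mul, Real.sq_sqrt (Real.sqrt_nonneg _), Real.sq_sqrt hk]

/-- `√(√k)·√k·√(√k) = k` (`k ≥ 0`). [folklore] -/
theorem sqrt_sqrt_mul_sqrt_mul_sqrt_sqrt {k : ℝ} (hk : 0 ≤ k) :
    Real.sqrt (Real.sqrt k) * Real.sqrt k * Real.sqrt (Real.sqrt k) = k := by
  have h1 : Real.sqrt (Real.sqrt k) * Real.sqrt (Real.sqrt k) = Real.sqrt k :=
    Real.mul_self_sqrt (Real.sqrt_nonneg _)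
  calc Real.sqrt (Real.sqrt k) * Real.sqrt k * Real.sqrt (Real.sqrt k)
      = (Real.sqrt (Real.sqrt k) * Real.sqrt (Real.sqrt k)) * Real.sqrt k := by ring
    _ = k := by rw [h1, Real.mul_self_sqrt hk]

/-- Weighted Hölder `(4,2,4)` against a nonnegative continuous weight `k`:
`(∫_a^b k f g)⁴ ≤ (∫ k f⁴)(∫ k)(∫ k g²)²` for continuous `f, g ≥ 0`... (no sign needed on `f, g`).
[folklore] -/
theorem pow_four_integral_weight_mul_mul_le {a b : ℝ} (hab : a ≤ b) {k f g : ℝ → ℝ}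
    (hk : Continuous k) (hf : Continuous f) (hg : Continuous g) (hk0 : ∀ x, 0 ≤ k x) :
    (∫ x in a..b, k x * (f x * g x)) ^ 4 ≤
      (∫ x in a..b, k x * f x ^ 4) * (∫ x in a..b, k x) * (∫ x in a..b, k x * g x ^ 2) ^ 2 := by
  have h := pow_four_integral_mul_mul_le hab (F := fun x ↦ Real.sqrt (Real.sqrt (k x)) * f x)
    (G := fun x ↦ Real.sqrt (k x) * g x) (H := fun x ↦ Real.sqrt (Real.sqrt (k x)))
    (by fun_prop) (by fun_prop) (by fun_prop)
  have e1 : ∫ x in a..b, Real.sqrt (Real.sqrt (k x)) * f x * (Real.sqrt (k x) * g x) *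
      Real.sqrt (Real.sqrt (k x)) = ∫ x in a..b, k x * (f x * g x) := by
    refine integral_congr fun x _ ↦ ?_
    have := sqrt_sqrt_mul_sqrt_mul_sqrt_sqrt (hk0 x)
    calc Real.sqrt (Real.sqrt (k x)) * f x * (Real.sqrt (k x) * g x) * Real.sqrt (Real.sqrt (k x))
        = (Real.sqrt (Real.sqrt (k x)) * Real.sqrt (k x) * Real.sqrt (Real.sqrt (k x))) *
            (f x * g x) := by ring
      _ = k x * (f x * g x) := by rw [this]
  have e2 : ∫ x in a..b, (Real.sqrt (Real.sqrt (k x)) * f x) ^ 4 = ∫ x in a..b, k x * f x ^ 4 := by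
    refine integral_congr fun x _ ↦ ?_
    simp only [mul_pow, sqrt_sqrt_pow_four (hk0 x)]
  have e3 : ∫ x in a..b, Real.sqrt (Real.sqrt (k x)) ^ 4 = ∫ x in a..b, k x := by
    refine integral_congr fun x _ ↦ ?_
    simp only [sqrt_sqrt_pow_four (hk0 x)]
  have e4 : ∫ x in a..b, (Real.sqrt (k x) * g x) ^ 2 = ∫ x in a..b, k x * g x ^ 2 := by
    refine integral_congr fun x _ ↦ ?_
    simp only [mul_pow, Real.sq_sqrt (hk0 x)]
  rw [e1, e2, e3, e4] at h
  exact h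

/-- From `X⁴ ≤ κ a b²` with `X, κ, a, b ≥ 0`: `X ≤ √(√(κ a)) √b`. [folklore] -/
theorem le_sqrt_sqrt_mul_sqrt_of_pow_four_le {X κ a b : ℝ} (hX : 0 ≤ X) (hκ : 0 ≤ κ) (ha : 0 ≤ a)
    (hb : 0 ≤ b) (h : X ^ 4 ≤ κ * a * b ^ 2) :
    X ≤ Real.sqrt (Real.sqrt (κ * a)) * Real.sqrt b := by
  have h0 : 0 ≤ Real.sqrt (Real.sqrt (κ * a)) * Real.sqrt b := by positivity
  refine (pow_le_pow_iff_left₀ hX h0 (by norm_num : (4 : ℕ) ≠ 0)).1 ?_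
  have e : (Real.sqrt (Real.sqrt (κ * a)) * Real.sqrt b) ^ 4 = κ * a * b ^ 2 := by
    rw [mul_pow, sqrt_sqrt_pow_four (by positivity)]
    have : Real.sqrt b ^ 4 = b ^ 2 := by
      rw [show (4 : ℕ) = 2 * 2 from rfl, pow_mul, Real.sq_sqrt hb]
    rw [this]
  rw [e]
  exact h

/-- Translation and enlargement of the window: for `0 ≤ γ - T`, `γ + T ≤ U` and `h ≥ 0` continuous,
`∫_{-T}^{T} w(y) h(γ + y) dy = ∫_{γ-T}^{γ+T} w(t-γ) h(t) dt ≤ ∫_0^U w(t - γ) h(t) dt` (`w ≥ 0`).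
[folklore] -/
theorem integral_window_le {w h : ℝ → ℝ} (hw : Continuous w) (hh : Continuous h)
    (hw0 : ∀ y, 0 ≤ w y) (hh0 : ∀ t, 0 ≤ h t) {γ T U : ℝ} (h1 : 0 ≤ γ - T) (h2 : γ + T ≤ U)
    (hT : 0 ≤ T) :
    ∫ y in (-T)..T, w y * h (γ + y) ≤ ∫ t in (0 : ℝ)..U, w (t - γ) * h t := by
  have e : ∫ y in (-T)..T, w y * h (γ + y) = ∫ t in (-T + γ)..(T + γ), w (t - γ) * h t := by
    rw [← intervalIntegral.integral_comp_add_right (fun t ↦ w (t - γ) * h t) γ]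
    refine integral_congr fun y _ ↦ ?_
    simp only [add_sub_cancel_right]
    rw [add_comm y γ]
  rw [e]
  refine intervalIntegral.integral_mono_interval (by linarith) (by linarith) (by linarith)
    (Filter.Eventually.of_forall fun t ↦ mul_nonneg (hw0 _) (hh0 _)) ?_
  exact ((hw.comp (continuous_id.sub continuous_const)).mul hh).intervalIntegrable _ _

/-- **The Class-II count** (Ivić 1985 §11.2, (11.10)/(11.19)–(11.20) with `A = 4`, in integral
form). Let `0 < η₀ ≤ 1/2`, `T ≥ 1`, `A > 0`, `ζf, Mf ≥ 0` continuous, and let `Z` be a finite set of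
points `ρ = β + iγ` with `η₀ ≤ β - 1/2 ≤ 1/2`, `T ≤ γ ≤ 2T`, ordinates pairwise `≥ 1` apart, each
with `A ≤ ∫_{-T}^{T} |K(1/2-β+iy)| ζf(γ+y) Mf(γ+y) dy`. Then
`A⁴ |Z|³ ≤ (2π/η₀²) ((2/η₀)(3/η₀²+4))³ (∫_0^{3T} ζf⁴)(∫_0^{3T} Mf²)²`
(Hölder with exponents `4, 4, 2` against the weight `|K|`, then over `ρ`; the kernel sums
`∑_ρ |K(1/2-β_ρ+i(t-γ_ρ))|` are bounded because the `γ_ρ` are `1`-spaced).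
[cite: Ivic1985, §11.2 (11.10), (11.19)–(11.20)] -/
theorem classTwo_core {η₀ T A : ℝ} (hη₀ : 0 < η₀) (hT : 1 ≤ T) (hA : 0 < A)
    {ζf Mf : ℝ → ℝ} (hζc : Continuous ζf) (hMc : Continuous Mf) (hζ0 : ∀ t, 0 ≤ ζf t)
    (hM0 : ∀ t, 0 ≤ Mf t) (Z : Finset ℂ)
    (hη : ∀ ρ ∈ Z, η₀ ≤ ρ.re - 1 / 2 ∧ ρ.re - 1 / 2 ≤ 1 / 2)
    (hγ : ∀ ρ ∈ Z, T ≤ ρ.im ∧ ρ.im ≤ 2 * T)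
    (hsep : ∀ ρ ∈ Z, ∀ ρ' ∈ Z, ρ ≠ ρ' → 1 ≤ |ρ.im - ρ'.im|)
    (hlarge : ∀ ρ ∈ Z, A ≤ ∫ y in (-T)..T,
      ‖ZeroDetect.rieszK (((1 / 2 - ρ.re : ℝ) : ℂ) + y * I)‖ * (ζf (ρ.im + y) * Mf (ρ.im + y))) :
    A ^ 4 * (Z.card : ℝ) ^ 3 ≤ (2 * π / η₀ ^ 2) * (2 / η₀ * (3 * (η₀ ^ 2)⁻¹ + 4)) ^ 3 *
      (∫ t in (0 : ℝ)..(3 * T), ζf t ^ 4) * (∫ t in (0 : ℝ)..(3 * T), Mf t ^ 2) ^ 2 := by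
  classical
  set κ : ℝ := 2 * π / η₀ ^ 2 with hκ
  set Bs : ℝ := 2 / η₀ * (3 * (η₀ ^ 2)⁻¹ + 4) with hBs
  set I4 : ℝ := ∫ t in (0 : ℝ)..(3 * T), ζf t ^ 4 with hI4
  set I2 : ℝ := ∫ t in (0 : ℝ)..(3 * T), Mf t ^ 2 with hI2
  have hκ0 : 0 ≤ κ := by positivity
  have hBs0 : 0 ≤ Bs := by positivity
  have h3T : (0 : ℝ) ≤ 3 * T := by linarith
  have hI40 : 0 ≤ I4 := integral_nonneg h3T fun t _ ↦ by positivity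
  have hI20 : 0 ≤ I2 := integral_nonneg h3T fun t _ ↦ by positivity
  -- the kernels
  set k : ℂ → ℝ → ℝ := fun ρ y ↦ ‖ZeroDetect.rieszK (((1 / 2 - ρ.re : ℝ) : ℂ) + y * I)‖ with hk
  have hk0 : ∀ ρ y, 0 ≤ k ρ y := fun ρ y ↦ norm_nonneg _
  have hke : ∀ ρ, k ρ = fun y : ℝ ↦ ‖ZeroDetect.rieszK (((-(ρ.re - 1 / 2) : ℝ) : ℂ) + y * I)‖ := fun ρ ↦ by
    simp only [hk]; rw [show (1 / 2 - ρ.re : ℝ) = -(ρ.re - 1 / 2) by ring]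
  have hkc : ∀ ρ ∈ Z, Continuous (k ρ) := fun ρ hρ ↦ by
    rw [hke]; exact continuous_norm_rieszK_neg_line (by linarith [(hη ρ hρ).1]) (hη ρ hρ).2
  have hkint : ∀ ρ ∈ Z, ∫ y in (-T)..T, k ρ y ≤ κ := fun ρ hρ ↦ by
    rw [hke]; exact integral_norm_rieszK_le hη₀ (hη ρ hρ).1 (hη ρ hρ).2 (by linarith)
  have hksum : ∀ t : ℝ, ∑ ρ ∈ Z, k ρ (t - ρ.im) ≤ Bs := fun t ↦ by
    have := sum_norm_rieszK_le hη₀ Z hη hsep t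
    simpa [hk] using this
  -- per-zero quantities
  set a : ℂ → ℝ := fun ρ ↦ ∫ y in (-T)..T, k ρ y * ζf (ρ.im + y) ^ 4 with ha
  set b : ℂ → ℝ := fun ρ ↦ ∫ y in (-T)..T, k ρ y * Mf (ρ.im + y) ^ 2 with hb
  have hTT : -T ≤ T := by linarith
  have ha0 : ∀ ρ, 0 ≤ a ρ := fun ρ ↦ integral_nonneg hTT fun y _ ↦ mul_nonneg (hk0 _ _) (by positivity)
  have hb0 : ∀ ρ, 0 ≤ b ρ := fun ρ ↦ integral_nonneg hTT fun y _ ↦ mul_nonneg (hk0 _ _) (by positivity)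
  -- Step 1: per-zero Hölder
  have hstep1 : ∀ ρ ∈ Z, A ≤ Real.sqrt (Real.sqrt (κ * a ρ)) * Real.sqrt (b ρ) := by
    intro ρ hρ
    have hH := pow_four_integral_weight_mul_mul_le hTT (hkc ρ hρ)
      (f := fun y ↦ ζf (ρ.im + y)) (g := fun y ↦ Mf (ρ.im + y)) (by fun_prop) (by fun_prop) (hk0 ρ)
    have hX0 : 0 ≤ ∫ y in (-T)..T, k ρ y * (ζf (ρ.im + y) * Mf (ρ.im + y)) :=
      integral_nonneg hTT fun y _ ↦ mul_nonneg (hk0 _ _) (mul_nonneg (hζ0 _) (hM0 _))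
    refine (hlarge ρ hρ).trans (le_sqrt_sqrt_mul_sqrt_of_pow_four_le hX0 hκ0 (ha0 ρ) (hb0 ρ) ?_)
    refine hH.trans ?_
    have hk1 := hkint ρ hρ
    have : (∫ y in (-T)..T, k ρ y * ζf (ρ.im + y) ^ 4) * (∫ y in (-T)..T, k ρ y) ≤ a ρ * κ :=
      mul_le_mul_of_nonneg_left hk1 (ha0 ρ)
    calc (∫ y in (-T)..T, k ρ y * ζf (ρ.im + y) ^ 4) * (∫ y in (-T)..T, k ρ y) *
          (∫ y in (-T)..T, k ρ y * Mf (ρ.im + y) ^ 2) ^ 2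
        ≤ (a ρ * κ) * (b ρ) ^ 2 := mul_le_mul_of_nonneg_right this (sq_nonneg _)
      _ = κ * a ρ * b ρ ^ 2 := by ring
  -- Step 2: sums of `a` and `b`
  have hsuma : ∑ ρ ∈ Z, a ρ ≤ Bs * I4 := by
    have h1 : ∀ ρ ∈ Z, a ρ ≤ ∫ t in (0 : ℝ)..(3 * T), k ρ (t - ρ.im) * ζf t ^ 4 := by
      intro ρ hρ
      exact integral_window_le (w := k ρ) (h := fun t ↦ ζf t ^ 4) (hkc ρ hρ) (by fun_prop) (hk0 ρ)
        (fun t ↦ by positivity) (by linarith [(hγ ρ hρ).1]) (by linarith [(hγ ρ hρ).2]) (by linarith)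
    refine (Finset.sum_le_sum h1).trans ?_
    have hcont : ∀ ρ ∈ Z, Continuous (fun t ↦ k ρ (t - ρ.im) * ζf t ^ 4) :=
      fun ρ hρ ↦ ((hkc ρ hρ).comp (continuous_id.sub continuous_const)).mul (hζc.pow 4)
    have hint : ∀ ρ ∈ Z, IntervalIntegrable (fun t ↦ k ρ (t - ρ.im) * ζf t ^ 4) volume 0 (3 * T) :=
      fun ρ hρ ↦ (hcont ρ hρ).intervalIntegrable _ _
    rw [← intervalIntegral.integral_finsetSum hint]
    calc ∫ t in (0 : ℝ)..(3 * T), ∑ ρ ∈ Z, k ρ (t - ρ.im) * ζf t ^ 4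
        ≤ ∫ t in (0 : ℝ)..(3 * T), Bs * ζf t ^ 4 := by
          refine intervalIntegral.integral_mono_on h3T ?_ ?_ fun t _ ↦ ?_
          · exact (continuous_finsetSum Z hcont).intervalIntegrable _ _
          · exact (continuous_const.mul (hζc.pow 4)).intervalIntegrable _ _
          · rw [← Finset.sum_mul]
            exact mul_le_mul_of_nonneg_right (hksum t) (by positivity)
      _ = Bs * I4 := by rw [intervalIntegral.integral_const_mul]
  have hsumb : ∑ ρ ∈ Z, b ρ ≤ Bs * I2 := by
    have h1 : ∀ ρ ∈ Z, b ρ ≤ ∫ t in (0 : ℝ)..(3 * T), k ρ (t - ρ.im) * Mf t ^ 2 := by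
      intro ρ hρ
      exact integral_window_le (w := k ρ) (h := fun t ↦ Mf t ^ 2) (hkc ρ hρ) (by fun_prop) (hk0 ρ)
        (fun t ↦ by positivity) (by linarith [(hγ ρ hρ).1]) (by linarith [(hγ ρ hρ).2]) (by linarith)
    refine (Finset.sum_le_sum h1).trans ?_
    have hcont : ∀ ρ ∈ Z, Continuous (fun t ↦ k ρ (t - ρ.im) * Mf t ^ 2) :=
      fun ρ hρ ↦ ((hkc ρ hρ).comp (continuous_id.sub continuous_const)).mul (hMc.pow 2)
    have hint : ∀ ρ ∈ Z, IntervalIntegrable (fun t ↦ k ρ (t - ρ.im) * Mf t ^ 2) volume 0 (3 * T) :=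
      fun ρ hρ ↦ (hcont ρ hρ).intervalIntegrable _ _
    rw [← intervalIntegral.integral_finsetSum hint]
    calc ∫ t in (0 : ℝ)..(3 * T), ∑ ρ ∈ Z, k ρ (t - ρ.im) * Mf t ^ 2
        ≤ ∫ t in (0 : ℝ)..(3 * T), Bs * Mf t ^ 2 := by
          refine intervalIntegral.integral_mono_on h3T ?_ ?_ fun t _ ↦ ?_
          · exact (continuous_finsetSum Z hcont).intervalIntegrable _ _
          · exact (continuous_const.mul (hMc.pow 2)).intervalIntegrable _ _
          · rw [← Finset.sum_mul]
            exact mul_le_mul_of_nonneg_right (hksum t) (by positivity)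
      _ = Bs * I2 := by rw [intervalIntegral.integral_const_mul]
  -- Step 3: discrete Hölder
  have hsum : A * Z.card ≤ ∑ ρ ∈ Z, Real.sqrt (Real.sqrt (κ * a ρ)) * Real.sqrt (b ρ) := by
    calc A * Z.card = ∑ ρ ∈ Z, A := by rw [Finset.sum_const, nsmul_eq_mul, mul_comm]
      _ ≤ _ := Finset.sum_le_sum hstep1
  have hdisc := pow_four_sum_sqrt_sqrt_mul_sqrt_le Z (a := fun ρ ↦ κ * a ρ) (b := b)
    (fun ρ _ ↦ mul_nonneg hκ0 (ha0 ρ)) (fun ρ _ ↦ hb0 ρ)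
  have h4 : (A * Z.card) ^ 4 ≤ Z.card * (κ * (Bs * I4)) * (Bs * I2) ^ 2 := by
    calc (A * Z.card) ^ 4 ≤ (∑ ρ ∈ Z, Real.sqrt (Real.sqrt (κ * a ρ)) * Real.sqrt (b ρ)) ^ 4 :=
          pow_le_pow_left₀ (by positivity) hsum 4
      _ ≤ Z.card * (∑ ρ ∈ Z, κ * a ρ) * (∑ ρ ∈ Z, b ρ) ^ 2 := hdisc
      _ ≤ Z.card * (κ * (Bs * I4)) * (Bs * I2) ^ 2 := by
          rw [← Finset.mul_sum]
          have h1 : κ * ∑ ρ ∈ Z, a ρ ≤ κ * (Bs * I4) := mul_le_mul_of_nonneg_left hsuma hκ0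
          have h2 : (∑ ρ ∈ Z, b ρ) ^ 2 ≤ (Bs * I2) ^ 2 :=
            pow_le_pow_left₀ (Finset.sum_nonneg fun ρ _ ↦ hb0 ρ) hsumb 2
          have h3 : 0 ≤ κ * ∑ ρ ∈ Z, a ρ := mul_nonneg hκ0 (Finset.sum_nonneg fun ρ _ ↦ ha0 ρ)
          exact mul_le_mul (mul_le_mul_of_nonneg_left h1 (Nat.cast_nonneg _)) h2 (sq_nonneg _)
            (by positivity)
  -- conclude
  rcases Nat.eq_zero_or_pos Z.card with hZ | hZ
  · rw [hZ]; simp only [Nat.cast_zero]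
    have : (0 : ℝ) ^ 3 = 0 := by norm_num
    rw [this, mul_zero]
    positivity
  · have hZ' : (0 : ℝ) < Z.card := by exact_mod_cast hZ
    have e : (A * Z.card) ^ 4 = (A ^ 4 * (Z.card : ℝ) ^ 3) * Z.card := by ring
    have e' : Z.card * (κ * (Bs * I4)) * (Bs * I2) ^ 2 = (κ * Bs ^ 3 * I4 * I2 ^ 2) * Z.card := by ring
    rw [e, e'] at h4
    exact le_of_mul_le_mul_right h4 hZ'




/-- A **well-spaced-set bound** at level `σ` with exponent `κ` and constant `C`: every finite set of
zeros `ρ` of `ζ` with `Re ρ ≥ σ`, `U < Im ρ ≤ 2U`, whose ordinates are pairwise `≥ 1` apart, has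
at most `C U^κ` elements (`U ≥ 1`). [folklore] -/
def WellSpacedBound (σ κ C : ℝ) : Prop :=
  ∀ U : ℝ, 1 ≤ U → ∀ Z : Finset ℂ,
    (∀ ρ ∈ Z, riemannZeta ρ = 0 ∧ σ ≤ ρ.re ∧ U < ρ.im ∧ ρ.im ≤ 2 * U) →
    (∀ ρ ∈ Z, ∀ ρ' ∈ Z, ρ ≠ ρ' → 1 ≤ |ρ.im - ρ'.im|) →
    (Z.card : ℝ) ≤ C * U ^ κ

/-- **Representatives and windows** (Ivić (11.12): "we may choose … zeros … so that the imaginary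
parts of these zeros differ from each other by at least …"): under a well-spaced-set bound,
`N(σ, 2U) − N(σ, U) ≤ 2 C U^κ · C_w log(2U + 3)` for `U ≥ 1`, `σ ≥ 1/4`, where `C_w` is the
constant of the unit-window count `∑_{|Im ρ − τ| ≤ 1/2} m(ρ) ≤ C_w log(|τ| + 2)`
(`Literature.NumberTheory.LFunctions.exists_sum_zetaZeroWindow_le`): group the zeros with `U < Im ρ ≤ 2U` by `⌊Im ρ⌋`, bound
each group by the window count, and bound the number of groups by choosing one zero per group and
splitting by the parity of `⌊Im ρ⌋`. [cite: Ivic1985, §11.2 (11.11)–(11.12)] -/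
theorem count_dyadic_le {σ κ C : ℝ} (hσ : 1 / 4 ≤ σ) (hws : WellSpacedBound σ κ C)
    {Cw : ℝ} (hCw : ∀ τ : ℝ, ∑ ρ ∈ (LFunctions.zetaZeroWindow_finite τ).toFinset,
      (riemannZetaZeroOrder ρ : ℝ) ≤ Cw * Real.log (|τ| + 2))
    {U : ℝ} (hU : 1 ≤ U) :
    (zetaZeroCountRe σ (2 * U) : ℝ) - zetaZeroCountRe σ U ≤
      2 * C * U ^ κ * (Cw * Real.log (2 * U + 3)) := by
  classical
  set B₁ := (zetaZeroBox_finite σ U).toFinset with hB₁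
  set B₂ := (zetaZeroBox_finite σ (2 * U)).toFinset with hB₂
  have hsub : B₁ ⊆ B₂ := by
    intro ρ hρ
    rw [hB₁, Set.Finite.mem_toFinset] at hρ
    rw [hB₂, Set.Finite.mem_toFinset]
    obtain ⟨h0, h1, h2, h3, h4⟩ := hρ
    exact ⟨h0, h1, h2, h3, by linarith⟩
  set D := B₂ \ B₁ with hD
  have hDmem : ∀ ρ ∈ D, riemannZeta ρ = 0 ∧ σ ≤ ρ.re ∧ ρ.re ≤ 1 ∧ U < ρ.im ∧ ρ.im ≤ 2 * U := by
    intro ρ hρ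
    rw [hD, Finset.mem_sdiff, hB₂, hB₁, Set.Finite.mem_toFinset, Set.Finite.mem_toFinset] at hρ
    obtain ⟨⟨h0, h1, h2, h3, h4⟩, hn⟩ := hρ
    refine ⟨h0, h1, h2, ?_, h4⟩
    by_contra hle
    exact hn ⟨h0, h1, h2, h3, not_lt.1 hle⟩
  have hdiff : (zetaZeroCountRe σ (2 * U) : ℝ) - zetaZeroCountRe σ U =
      ∑ ρ ∈ D, (riemannZetaZeroOrder ρ : ℝ) := by
    rw [natCast_zetaZeroCountRe, natCast_zetaZeroCountRe, ← hB₁, ← hB₂,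
      ← Finset.sum_sdiff hsub, hD]
    ring
  rw [hdiff]
  -- group by `k = ⌊Im ρ⌋`
  set f : ℂ → ℤ := fun ρ ↦ ⌊ρ.im⌋ with hf
  set Kset := D.image f with hKset
  have hfib : ∀ k ∈ Kset, ∑ ρ ∈ D with f ρ = k, (riemannZetaZeroOrder ρ : ℝ) ≤
      Cw * Real.log (2 * U + 3) := by
    intro k hk
    have hk0 : (1 : ℝ) ≤ k := by
      rw [hKset, Finset.mem_image] at hk
      obtain ⟨ρ, hρ, rfl⟩ := hk
      have h1 : (1 : ℤ) ≤ ⌊ρ.im⌋ := Int.le_floor.2 (by push_cast; linarith [(hDmem ρ hρ).2.2.2.1])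
      exact_mod_cast h1
    have hkU : (k : ℝ) ≤ 2 * U := by
      rw [hKset, Finset.mem_image] at hk
      obtain ⟨ρ, hρ, rfl⟩ := hk
      exact (Int.floor_le ρ.im).trans (hDmem ρ hρ).2.2.2.2
    set τ : ℝ := (k : ℝ) + 1 / 2 with hτ
    have hsubw : D.filter (fun ρ ↦ f ρ = k) ⊆ (LFunctions.zetaZeroWindow_finite τ).toFinset := by
      intro ρ hρ
      rw [Finset.mem_filter] at hρ
      rw [Set.Finite.mem_toFinset]
      obtain ⟨hρD, hρk⟩ := hρ
      obtain ⟨h0, h1, -, -, -⟩ := hDmem ρ hρD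
      refine ⟨h0, hσ.trans h1, ?_⟩
      have hfl := Int.floor_le ρ.im
      have hlt := Int.lt_floor_add_one ρ.im
      rw [show f ρ = ⌊ρ.im⌋ from rfl] at hρk
      rw [hρk] at hfl hlt
      rw [hτ, abs_le]
      constructor <;> linarith
    calc ∑ ρ ∈ D with f ρ = k, (riemannZetaZeroOrder ρ : ℝ)
        ≤ ∑ ρ ∈ (LFunctions.zetaZeroWindow_finite τ).toFinset, (riemannZetaZeroOrder ρ : ℝ) := by
          refine Finset.sum_le_sum_of_subset_of_nonneg hsubw fun ρ hρ _ ↦ ?_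
          rw [Set.Finite.mem_toFinset] at hρ
          exact LFunctions.riemannZetaZeroOrder_nonneg_of_zero hρ.1
      _ ≤ Cw * Real.log (|τ| + 2) := hCw τ
      _ ≤ Cw * Real.log (2 * U + 3) := by
          have hCw0 : 0 ≤ Cw := by
            have h := hCw 0
            have h0 : (0 : ℝ) ≤ ∑ ρ ∈ (LFunctions.zetaZeroWindow_finite 0).toFinset,
                (riemannZetaZeroOrder ρ : ℝ) := Finset.sum_nonneg fun ρ hρ ↦ by
              rw [Set.Finite.mem_toFinset] at hρ
              exact LFunctions.riemannZetaZeroOrder_nonneg_of_zero hρ.1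
            have hl : 0 < Real.log (|(0 : ℝ)| + 2) := by simp; exact Real.log_pos (by norm_num)
            nlinarith
          refine mul_le_mul_of_nonneg_left (Real.log_le_log (by positivity) ?_) hCw0
          rw [hτ, abs_of_pos (by linarith)]
          linarith
  -- number of groups
  have hcardK : (Kset.card : ℝ) ≤ 2 * C * U ^ κ := by
    -- a section of `f` on `Kset`
    have hex : ∀ k ∈ Kset, ∃ ρ ∈ D, f ρ = k := fun k hk ↦ by
      simpa [hKset, Finset.mem_image] using hk
    choose! g hgD hgf using hex
    have hginj : Set.InjOn g Kset := by
      intro k hk k' hk' h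
      rw [← hgf k hk, ← hgf k' hk', h]
    -- parity classes
    have hclass : ∀ P : Finset ℤ, P ⊆ Kset → (∀ k ∈ P, ∀ k' ∈ P, k ≠ k' → 2 ≤ |k - k'|) →
        (P.card : ℝ) ≤ C * U ^ κ := by
      intro P hP hP2
      have hcard : (P.image g).card = P.card := Finset.card_image_of_injOn (hginj.mono hP)
      rw [← hcard]
      refine hws U hU (P.image g) (fun ρ hρ ↦ ?_) (fun ρ hρ ρ' hρ' hne ↦ ?_)
      · rw [Finset.mem_image] at hρ
        obtain ⟨k, hk, rfl⟩ := hρ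
        obtain ⟨h0, h1, -, h3, h4⟩ := hDmem _ (hgD k (hP hk))
        exact ⟨h0, h1, h3, h4⟩
      · rw [Finset.mem_image] at hρ hρ'
        obtain ⟨k, hk, rfl⟩ := hρ
        obtain ⟨k', hk', rfl⟩ := hρ'
        have hkk : k ≠ k' := fun h ↦ hne (by rw [h])
        have h2 := hP2 k hk k' hk' hkk
        have e1 : ⌊(g k).im⌋ = k := hgf k (hP hk)
        have e2 : ⌊(g k').im⌋ = k' := hgf k' (hP hk')
        have hfl := Int.floor_le (g k).im
        have hlt := Int.lt_floor_add_one (g k).im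
        have hfl' := Int.floor_le (g k').im
        have hlt' := Int.lt_floor_add_one (g k').im
        rw [e1] at hfl hlt
        rw [e2] at hfl' hlt'
        have h2' : (2 : ℝ) ≤ |(k : ℝ) - k'| := by exact_mod_cast h2
        rcases le_total (k : ℝ) k' with hle | hle
        · rw [abs_of_nonpos (by linarith)] at h2'
          rw [abs_of_nonpos (by linarith)]
          linarith
        · rw [abs_of_nonneg (by linarith)] at h2'
          rw [abs_of_nonneg (by linarith)]
          linarith
    have hE := hclass (Kset.filter (fun k ↦ Even k)) (Finset.filter_subset _ _) (by
      intro k hk k' hk' hne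
      rw [Finset.mem_filter] at hk hk'
      have : Even (k - k') := Int.even_sub.2 (iff_of_true hk.2 hk'.2)
      obtain ⟨r, hr⟩ := this
      rw [hr, show r + r = 2 * r by ring, abs_mul, abs_two]
      have : r ≠ 0 := by rintro rfl; simp at hr; exact hne (by linarith)
      have : 1 ≤ |r| := Int.one_le_abs this
      linarith)
    have hO := hclass (Kset.filter (fun k ↦ ¬ Even k)) (Finset.filter_subset _ _) (by
      intro k hk k' hk' hne
      rw [Finset.mem_filter] at hk hk'
      have : Even (k - k') := Int.even_sub.2 (iff_of_false hk.2 hk'.2)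
      obtain ⟨r, hr⟩ := this
      rw [hr, show r + r = 2 * r by ring, abs_mul, abs_two]
      have : r ≠ 0 := by rintro rfl; simp at hr; exact hne (by linarith)
      have : 1 ≤ |r| := Int.one_le_abs this
      linarith)
    have hsplit := Finset.card_filter_add_card_filter_not (s := Kset) (fun k ↦ Even k)
    have : (Kset.card : ℝ) = ((Kset.filter (fun k ↦ Even k)).card : ℝ) +
        ((Kset.filter (fun k ↦ ¬ Even k)).card : ℝ) := by exact_mod_cast hsplit.symm
    rw [this]
    linarith
  -- assemble
  have hmaps : ∀ ρ ∈ D, f ρ ∈ Kset := fun ρ hρ ↦ Finset.mem_image_of_mem f hρ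
  rw [← Finset.sum_fiberwise_of_maps_to hmaps]
  have hlog0 : 0 ≤ Cw * Real.log (2 * U + 3) := by
    have h := hfib
    rcases Kset.eq_empty_or_nonempty with hK | ⟨k, hk⟩
    · -- irrelevant in this case; prove directly
      have hCw0 : 0 ≤ Cw := by
        have h := hCw 0
        have h0 : (0 : ℝ) ≤ ∑ ρ ∈ (LFunctions.zetaZeroWindow_finite 0).toFinset,
            (riemannZetaZeroOrder ρ : ℝ) := Finset.sum_nonneg fun ρ hρ ↦ by
          rw [Set.Finite.mem_toFinset] at hρ
          exact LFunctions.riemannZetaZeroOrder_nonneg_of_zero hρ.1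
        have hl : 0 < Real.log (|(0 : ℝ)| + 2) := by simp; exact Real.log_pos (by norm_num)
        nlinarith
      exact mul_nonneg hCw0 (Real.log_nonneg (by linarith))
    · refine le_trans (Finset.sum_nonneg fun ρ hρ ↦ ?_) (hfib k hk)
      rw [Finset.mem_filter] at hρ
      exact LFunctions.riemannZetaZeroOrder_nonneg_of_zero (hDmem ρ hρ.1).1
  calc ∑ k ∈ Kset, ∑ ρ ∈ D with f ρ = k, (riemannZetaZeroOrder ρ : ℝ)
      ≤ ∑ k ∈ Kset, Cw * Real.log (2 * U + 3) := Finset.sum_le_sum hfib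
    _ = Kset.card * (Cw * Real.log (2 * U + 3)) := by rw [Finset.sum_const, nsmul_eq_mul]
    _ ≤ 2 * C * U ^ κ * (Cw * Real.log (2 * U + 3)) :=
        mul_le_mul_of_nonneg_right hcardK hlog0

/-- `N(σ, T)` is non-decreasing in `T` (real-valued form). [folklore] -/
theorem natCast_zetaZeroCountRe_mono (σ : ℝ) {T T' : ℝ} (h : T ≤ T') :
    (zetaZeroCountRe σ T : ℝ) ≤ zetaZeroCountRe σ T' := by
  exact_mod_cast zetaZeroCountRe_mono_right_holds σ h

/-- **Dyadic summation.** If `N(σ, 2U) − N(σ, U) ≤ C' U^κ log(2U + 3)` for all `U ≥ 1`, with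
`κ > 0`, then `N(σ, T) = O_δ(T^{κ+δ})` for every `δ > 0`. [folklore] -/
theorem isBigO_of_dyadic {σ κ C' : ℝ} (hκ : 0 < κ) (hC' : 0 ≤ C')
    (h : ∀ U : ℝ, 1 ≤ U → (zetaZeroCountRe σ (2 * U) : ℝ) - zetaZeroCountRe σ U ≤
      C' * U ^ κ * Real.log (2 * U + 3))
    {δ : ℝ} (hδ : 0 < δ) :
    (fun T : ℝ ↦ (zetaZeroCountRe σ T : ℝ)) =O[atTop] fun T : ℝ ↦ T ^ (κ + δ) := by
  -- telescoping over `U_j = T/2^{j+1}`, `j < J`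
  have key : ∀ (J : ℕ) (T : ℝ), 1 ≤ T / 2 ^ J →
      (zetaZeroCountRe σ T : ℝ) ≤ zetaZeroCountRe σ (T / 2 ^ J) +
        C' * Real.log (2 * T + 3) * (∑ j ∈ Finset.range J, (T / 2 ^ (j + 1)) ^ κ) := by
    intro J
    induction J with
    | zero => intro T hT; simp
    | succ J ih =>
      intro T hT
      have hT1 : 1 ≤ T / 2 / 2 ^ J := by rw [div_div, ← pow_succ']; exact hT
      have hpos : (0 : ℝ) < 2 ^ (J + 1) := by positivity
      have hT0 : 0 ≤ T := by
        have := (le_div_iff₀ hpos).1 hT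
        linarith
      have hU : 1 ≤ T / 2 := by
        have h2J : (2 : ℝ) ≤ 2 ^ (J + 1) := by
          calc (2 : ℝ) = 2 ^ 1 := by norm_num
            _ ≤ 2 ^ (J + 1) := pow_le_pow_right₀ (by norm_num) (by omega)
        have := (le_div_iff₀ hpos).1 hT
        linarith
      have h1 := ih (T / 2) hT1
      have h2 := h (T / 2) hU
      rw [show 2 * (T / 2) = T by ring] at h2
      have hlog : Real.log (2 * (T / 2) + 3) ≤ Real.log (2 * T + 3) :=
        Real.log_le_log (by linarith) (by linarith)
      have hlog0 : 0 ≤ Real.log (2 * (T / 2) + 3) := Real.log_nonneg (by linarith)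
      have e1 : T / 2 / 2 ^ J = T / 2 ^ (J + 1) := by rw [div_div, ← pow_succ']
      have e2 : ∑ j ∈ Finset.range J, (T / 2 / 2 ^ (j + 1)) ^ κ =
          ∑ j ∈ Finset.range J, (T / 2 ^ (j + 1 + 1)) ^ κ :=
        Finset.sum_congr rfl fun j _ ↦ by rw [div_div, ← pow_succ']
      rw [e1, e2] at h1
      have hsum0 : 0 ≤ ∑ j ∈ Finset.range J, (T / 2 ^ (j + 1 + 1)) ^ κ :=
        Finset.sum_nonneg fun j _ ↦ Real.rpow_nonneg (by positivity) _
      have hpow0 : 0 ≤ (T / 2) ^ κ := Real.rpow_nonneg (by linarith) _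
      rw [Finset.sum_range_succ', pow_one]
      have h3 : C' * Real.log (2 * (T / 2) + 3) * ∑ j ∈ Finset.range J, (T / 2 ^ (j + 1 + 1)) ^ κ ≤
          C' * Real.log (2 * T + 3) * ∑ j ∈ Finset.range J, (T / 2 ^ (j + 1 + 1)) ^ κ :=
        mul_le_mul_of_nonneg_right (mul_le_mul_of_nonneg_left hlog hC') hsum0
      have hlogT : Real.log (T + 3) ≤ Real.log (2 * T + 3) :=
        Real.log_le_log (by linarith) (by linarith)
      have h4 : C' * (T / 2) ^ κ * Real.log (T + 3) ≤
          C' * Real.log (2 * T + 3) * (T / 2) ^ κ := by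
        rw [mul_assoc, mul_comm ((T / 2) ^ κ), ← mul_assoc]
        exact mul_le_mul_of_nonneg_right (mul_le_mul_of_nonneg_left hlogT hC') hpow0
      linarith
  -- geometric sum: `∑_{j<J} (T/2^{j+1})^κ ≤ T^κ/(2^κ - 1)`
  set r : ℝ := (2 : ℝ) ^ (-κ) with hr
  have hr0 : 0 ≤ r := Real.rpow_nonneg (by norm_num) _
  have hr1 : r < 1 := Real.rpow_lt_one_of_one_lt_of_neg (by norm_num) (by linarith)
  have hgeom : ∀ (J : ℕ) (T : ℝ), 0 ≤ T →
      ∑ j ∈ Finset.range J, (T / 2 ^ (j + 1)) ^ κ ≤ T ^ κ * (r / (1 - r)) := by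
    intro J T hT
    have e : ∀ j : ℕ, (T / 2 ^ (j + 1)) ^ κ = T ^ κ * r ^ (j + 1) := by
      intro j
      rw [Real.div_rpow hT (by positivity), hr, ← Real.rpow_natCast,
        ← Real.rpow_mul (by norm_num), ← Real.rpow_natCast, ← Real.rpow_mul (by norm_num),
        div_eq_mul_inv, ← Real.rpow_neg (by norm_num)]
      congr 1
      push_cast
      ring_nf
    simp_rw [e, ← Finset.mul_sum]
    refine mul_le_mul_of_nonneg_left ?_ (Real.rpow_nonneg hT _)
    have h1 : ∑ j ∈ Finset.range J, r ^ (j + 1) = ∑ i ∈ Finset.Ico 1 (J + 1), r ^ i := by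
      rw [Finset.sum_Ico_eq_sum_range]
      simp only [add_tsub_cancel_right]
      exact Finset.sum_congr rfl fun j _ ↦ by rw [add_comm]
    rw [h1]
    have := geom_sum_Ico_le_of_lt_one hr0 hr1 (m := 1) (n := J + 1)
    simpa using this
  -- the eventual bound
  set A : ℝ := (zetaZeroCountRe σ 2 : ℝ) with hA
  set B : ℝ := C' * (r / (1 - r)) with hB
  have hB0 : 0 ≤ B := by rw [hB]; exact mul_nonneg hC' (div_nonneg hr0 (by linarith))
  have hbound : ∀ T : ℝ, 2 ≤ T → (zetaZeroCountRe σ T : ℝ) ≤ A + B * T ^ κ * Real.log (4 * T) := by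
    intro T hT
    -- choose `J` with `1 ≤ T/2^J < 2`
    obtain ⟨J, hJ1, hJ2⟩ : ∃ J : ℕ, 1 ≤ T / 2 ^ J ∧ T / 2 ^ J ≤ 2 := by
      refine ⟨Nat.log 2 ⌊T⌋₊, ?_, ?_⟩
      · rw [le_div_iff₀ (by positivity), one_mul]
        have h1 : (2 : ℕ) ^ Nat.log 2 ⌊T⌋₊ ≤ ⌊T⌋₊ := Nat.pow_log_le_self 2 (by
          have : 2 ≤ ⌊T⌋₊ := Nat.le_floor (by exact_mod_cast hT); omega)
        have h2 : ((2 : ℕ) ^ Nat.log 2 ⌊T⌋₊ : ℝ) ≤ (⌊T⌋₊ : ℝ) := by exact_mod_cast h1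
        push_cast at h2
        exact h2.trans (Nat.floor_le (by linarith))
      · rw [div_le_iff₀ (by positivity)]
        have h1 : ⌊T⌋₊ < 2 ^ (Nat.log 2 ⌊T⌋₊ + 1) := Nat.lt_pow_succ_log_self (by norm_num) _
        have h2 : (⌊T⌋₊ : ℝ) + 1 ≤ ((2 ^ (Nat.log 2 ⌊T⌋₊ + 1) : ℕ) : ℝ) := by exact_mod_cast h1
        push_cast at h2
        have h3 : T < (⌊T⌋₊ : ℝ) + 1 := Nat.lt_floor_add_one T
        rw [pow_succ] at h2
        linarith
    have h1 := key J T hJ1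
    have h2 : (zetaZeroCountRe σ (T / 2 ^ J) : ℝ) ≤ A := natCast_zetaZeroCountRe_mono σ hJ2
    have h3 := hgeom J T (by linarith)
    have hlog : Real.log (2 * T + 3) ≤ Real.log (4 * T) := Real.log_le_log (by linarith) (by linarith)
    have hlog0 : 0 ≤ Real.log (2 * T + 3) := Real.log_nonneg (by linarith)
    have hTk : 0 ≤ T ^ κ := Real.rpow_nonneg (by linarith) _
    calc (zetaZeroCountRe σ T : ℝ)
        ≤ zetaZeroCountRe σ (T / 2 ^ J) +
          C' * Real.log (2 * T + 3) * ∑ j ∈ Finset.range J, (T / 2 ^ (j + 1)) ^ κ := h1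
      _ ≤ A + C' * Real.log (2 * T + 3) * (T ^ κ * (r / (1 - r))) := by
          gcongr
      _ = A + B * T ^ κ * Real.log (2 * T + 3) := by rw [hB]; ring
      _ ≤ A + B * T ^ κ * Real.log (4 * T) := by gcongr
  -- `=O(T^{κ+δ})`
  have hA0 : 0 ≤ A := Nat.cast_nonneg _
  refine IsBigO.of_bound (A + B * (2 + 1 / δ)) ?_
  filter_upwards [eventually_ge_atTop (2 : ℝ)] with T hT
  have hT1 : (1 : ℝ) ≤ T := by linarith
  rw [Real.norm_of_nonneg (Nat.cast_nonneg _), Real.norm_of_nonneg (Real.rpow_nonneg (by linarith) _)]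
  have hTkd : T ^ (κ + δ) = T ^ κ * T ^ δ := Real.rpow_add (by linarith) _ _
  have hTd1 : 1 ≤ T ^ δ := Real.one_le_rpow hT1 hδ.le
  have hTk1 : 1 ≤ T ^ κ := Real.one_le_rpow hT1 hκ.le
  have hlogT : Real.log T ≤ T ^ δ / δ := Real.log_le_rpow_div (by linarith) hδ
  have hlog4 : Real.log 4 ≤ 2 := by
    have h2 : Real.log 2 ≤ 1 := Real.log_two_lt_d9.le.trans (by norm_num)
    have : Real.log 4 = 2 * Real.log 2 := by
      rw [show (4 : ℝ) = 2 ^ 2 by norm_num, Real.log_pow]; norm_num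
    linarith
  have hlog4T : Real.log (4 * T) ≤ (2 + 1 / δ) * T ^ δ := by
    rw [Real.log_mul (by norm_num) (by linarith)]
    have : Real.log 4 ≤ 2 * T ^ δ := by nlinarith
    have : Real.log T ≤ (1 / δ) * T ^ δ := by rw [one_div_mul_eq_div]; exact hlogT
    linarith
  calc (zetaZeroCountRe σ T : ℝ) ≤ A + B * T ^ κ * Real.log (4 * T) := hbound T hT
    _ ≤ A * (T ^ κ * T ^ δ) + B * T ^ κ * ((2 + 1 / δ) * T ^ δ) := by
        have h1 : A ≤ A * (T ^ κ * T ^ δ) := le_mul_of_one_le_right hA0 (one_le_mul_of_one_le_of_one_le hTk1 hTd1)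
        have h2 : B * T ^ κ * Real.log (4 * T) ≤ B * T ^ κ * ((2 + 1 / δ) * T ^ δ) :=
          mul_le_mul_of_nonneg_left hlog4T (by positivity)
        linarith
    _ = (A + B * (2 + 1 / δ)) * T ^ (κ + δ) := by rw [hTkd]; ring


end ZeroDensity

end Literature.NumberTheory.LFunctions
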